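import Literature.MathematicalPhysics.QuantumFieldTheory.Balaban1983to89.Node00.OpsYSectEStarGeometry
import Literature.MathematicalPhysics.QuantumFieldTheory.Balaban1983to89.Node00.OpsYSectEPrintUnits

/-!
# `Balaban1983to89.Node00.OpsYSectEStar` — T. Bałaban, *Propagators for lattice gauge theories in a background field*, Commun. Math. Phys. **99**
# (1985) 389–434 [Balaban1985BackgroundPropagators], Sect. E (3.155)–(3.158) pp. 427–428, (3.185) p. 432, with [4] = *Propagators … II*, CMP **96** (1984)
# 223–250 [Balaban1984PropagatorsII], (2.3) p. 224 ∕ Lemma 2.4 p. 245: NODE 00's SECT. E LETTERS IN THE STAR CONVENTION — STAR EDITION, PART 2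
# (the letter record `SectELettersStY`, the star sector `P_Λ^st`, the dressed letters `Δ_k ∕ C ∕ C* ∕ C*Δ_kC ∕ C̃^{(k)}(Λ) ∕ C^{(k)}(Λ)` and their
# print-unit currency, the (3.185) slot, the layer update and the family type `SectEStY`)

statement-level construction with citation tags; proofs where landed; nothing here is a claim about the Yang–Mills mass gap, the continuum limit or OS.

THE PRINT.  p. 428: *«This form is considered on the subspace {B : B = 0 on Λᶜ, B = 0 on ⋃_{y∈Λ′} Ax(y), Q₁B = 0}. We can parametrize this subspace …
using part of the variables B, which we denote by B̃. These are variables B restricted to the set of bonds Λ̃ = Λ ∖ (⋃_{y∈Λ′} Ax(y) ∪ ⋃_{c∈Λ′} (B(c) ∩ c)).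
… B = CB̃ … (C\*Δ_kC)⁻¹ = C̃^{(k)}(Λ), C^{(k)}(Λ) = C C̃^{(k)}(Λ) C\*. (3.158)»*; [4] (2.3) p. 224: *«If Ω ⊂ T_η, then we denote by Ω also the set of bonds
⋃_{x∈Ω} st(x) = {bonds b ⊂ T_η : at least one end-point of b belongs to Ω}»*; [4] Lemma 2.4 p. 245: *«We denote by Λ also a set of bonds b such that at
least one of the end-points b₋, b₊ belongs to Λ»* — the STAR convention for «B on Λ».

WHY THIS FILE (node00-def-Y g25 SUCCESSOR ITEM #1, WORD-L ∕ ruling (a′); dag-n08-b CHECK-L 2026-08-29).  `Node00.OpsYSectE` dresses the parametrisation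
letters through the SOURCE sector `secΛY x := secY 𝔸 (inΛY x)` (base point in `Λ`) and its letter record `SectELettersY` demands `LamT_inΛ : Λ̃ ⊆ inΛY`;
print's variables are the STAR set (bonds with at least one end block in `Λ′`), which on NODE 00's carrier is `OpsYSectEStarGeometry.inΛstY` (STAR EDITION
part 1, p689888).  A star `Λ̃` is NOT inside `inΛY`, so the star letters need a side-by-side letter record and side-by-side dressed letters over the star sector
— THIS FILE (nothing of `OpsYSectE` ∕ `OpsYSectEPrintUnits` is edited; every old decl stays as the source-convention edition):
* §0 THE ONE MISSING ARROW `inΛY → inΛstY` (def-Y review condition (r1)): `k_succ_le_mK` (`k + 1 ≤ m + K`, from `sitesPerDir_k`), `val_div_eq_of_blockOf_eq`,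
  ★ `mem_Λ_iff_of_blockOf_iterBlockOf_eq` (`Λ` IS A UNION OF `(k+1)`-BLOCKS: big blocks `hΛblocks` have side `M_h·L^{k+1}`), ★ `goodY_iterBlockOf_of_mem_Λ`,
  ★★ `inΛstY_of_inΛY` (a bond whose BASE block lies in `Λ` has a good source or target block), `secY_inΛstY_mul_secΛY` (`P_Λ^st P_Λ = P_Λ`).
* §1 `secΛstY x := secY 𝔸 (inΛstY x)` — the STAR SECTOR `P_Λ^st`; `secΛstY_idem`, `mul_secΛstY_mul_secΛstY`.
* §2 ★ `SectELettersStY 𝔸 x` — the residual Sect. E letter record with `LamT_inΛst : Λ̃ ⊆ inΛstY` (all other fields as `SectELettersY`: `D2J ∕ D2J_one ∕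
  elimC ∕ elimCt ∕ mu ∕ muT ∕ Dbar ∕ DbarT ∕ Gt2`, same order); `sectELettersStY_flat`; `SectELettersStY.ofParams` (a `SectELettersY`'s SECTOR-FREE fields with
  a given star `Λ̃ ∕ C ∕ C*` — the shape part 3's record constructor uses); ★ `SectELettersY.toStar` (the field-copy coercion, `LamT_inΛst` by §0) with
  `toStar_fields`, `deltaKstY_toStar ∕ deltaKPstY_toStar` (`rfl`), `secΛstY_mul_elimCΛY` (the old dressed `C` is star-Dirichlet).
* §3 THE DRESSED STAR LETTERS (twins of `OpsYSectE` §4 over `secΛstY`): ★ `deltaKstY x 𝔏 𝔢 U := 𝔏.QG1Qinv U − a − 𝔢.D2J U` ((3.156); the same formula as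
  `deltaKY`, re-typed on the star record: `deltaKstY_apply ∕ _one ∕ _one_v3`, `deltaKstY_eq_deltaKY` for records with equal `D2J`), `elimCΛstY := P_Λ^st C P_Λ̃`,
  `elimCtΛstY := P_Λ̃ C* P_Λ^st`, `CsDeltaCstY := C*Δ_kC`, ★ `CtildeKstY := secInvY Λ̃ (C*Δ_kC)` ((3.158)₁), ★★ `CkStY := C C̃^{(k)}(Λ) C*` ((3.158)₂) with the
  faces `CkStY_apply`, `secΛstY_mul_CkStY ∕ CkStY_mul_secΛstY` (Dirichlet in the STAR sense: `C^{(k)}(Λ)` lives on the bonds with an end block in `Λ′`),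
  `secY_mul_CtildeKstY ∕ CtildeKstY_mul_secY`, `secY_mul_CsDeltaCstY_mul_secY`, ★ `CsDeltaCstY_mul_CtildeKstY ∕ CtildeKstY_mul_CsDeltaCstY = P_Λ̃` under the
  unit hypothesis, `CkStY_flat`.
* §4 THE PRINT-UNIT STAR LETTERS (twins of `OpsYSectEPrintUnits` §3; the scale `etaDY` is def-Y's, sector-free, by name): `deltaKPstY := η^{d+1} • deltaKstY`,
  `CsDeltaCPstY`, `CtildeKPstY := η^{−(d+1)} • CtildeKstY`, `CkPstY` and the dictionary (`…_apply ∕ …_apply_apply ∕ norm_…_apply`, `deltaKPstY_eq_sub ∕ _one`,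
  `CsDeltaCPstY_eq` (`= C*·deltaKPstY·C`), `CkPstY_eq`, ★★ `CtildeKPstY_eq_secInvY`, `isUnit_secCornerY_CsDeltaCPstY_iff`, the inverse pair, Dirichlet ∕
  support faces, `deltaKstY_eq_smul_deltaKPstY ∕ CkStY_eq_smul_CkPstY`, `deltaKPstY_eq_deltaKPY`).
* §5 THE (3.185) SLOT over the star sector: `rhs3185stY`, ★★ `givenBy3185stY x 𝔏 𝔢 U : Prop := CkStY … U = rhs3185stY … U`, `_iff`, Dirichlet faces, `_flat`.
* §6 THE LAYER UPDATE ★★ `operatorLayerYSectESt 𝔸 G x ops 𝔏 𝔢 𝔴 := { ops with Ck := ⟨index-bond kernel of CkStY⟩, GivenBy3185 := givenBy3185stY …, HasRWExpC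
  := hasRWExpCY 𝔴 }` (the walk letter `RWLettersEY` and its slot `hasRWExpCY` are `OpsYSectE`'s, UNCHANGED — the (3.187)-type rows stay indexed by `inΛY`
  pairs, a sub-block of the star operator), its twenty `rfl` field lemmas and `operatorLayerYSectESt_Ck_ker_flat`.
* §7 RECORD LEVEL (`𝔸 = M_N(ℂ)`, `G = SU(N)`): `SectEStY N θ M⋆`, `sectEStY_flat`, ★ `opsYSectESt N θ M⋆ ops 𝔏 𝔢 𝔴` (generic base family), ★★ `opsYStOfRecordV4E
  N θ M⋆ 𝔯 𝔢 𝔴 𝔈 := opsYSectESt … (opsYS349OfRecordV4 … 𝔯 𝔈) (lettersYOfRecordV4 … 𝔯) 𝔢 𝔴` (the v4 instance at STAR Sect. E letters — the shape every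
  `…V4E ∕ V6E ∕ V7E ∕ V8E` consumer reads, `𝔢 : SectEStY` generic; the star record of `Λ̃ ∕ C ∕ C*` is part 3's `sectEStYOfRecordV7`), with `_apply ∕ _Ck ∕
  _Ck_ker ∕ _GivenBy3185 ∕ _HasRWExpC ∕ _letters ∕ _exps ∕ _Ck_ker_flat`, `Y9OfRecord_opsYStOfRecordV4E`, ★ `t315_opsYStOfRecordV4E_iff` (row 24's face at
  the star instance unfolds to Thm 3.15 about the kernel of `CkStY`, `Iff.rfl`), `t315_opsYStOfRecordV4E_flat` (honesty guard).

HONEST MARGINS. (i) Exactly as `OpsYSectE`: finite-dimensional lattice algebra realising the printed FORMULAS (3.156)–(3.158), (3.185) over located residual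
letters; no inequality of the paper; inverses are `Ring.inverse` ∕ `secInvY`, genuine where the corner is a unit (p. 428's «lower bound γ₀», [4] Lemma 2.4 at
`U = 1`, Sect. B in general — NOT claimed here).  (ii) STAR vs SOURCE: the old `secΛY ∕ SectELettersY ∕ CkY ∕ …` decls remain the source-convention edition
(their theorems are correct implications on a narrower door, dag-n08-b CHECK-L); consumers choose the edition by name; `OpsYSectEElim`'s HONEST MARGIN (i)
(«a bond leaving `Λ′` carries no constraint here») is the located defect the star edition repairs — part 3 (`OpsYSectEElimStar`) indexes the constraints
by `CBondStY` (at least one good end block).  (iii) The Thm 3.15 kernel rows (`hasRWExpCY`, r1's `Thm315FullPrinted … inΛY unitDistY`) keep the `inΛY` pair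
index (def-Y TYPE MAP: «(3.187) rows indexed by `inΛY` pairs stay true (source-indexed sub-block of the star operator)»).  (iv) `deltaKstY ∕ deltaKPstY` are
the SAME formulas as def-Y's `deltaKY ∕ deltaKPY` re-typed on the star record (a `SectELettersStY` cannot be fed to `deltaKY`); `deltaKstY_eq_deltaKY ∕
deltaKPstY_eq_deltaKPY ∕ _toStar ∕ _ofParams` bridge them, `etaDY` is used by name.  Net new unproved facts: 0.  Filed by seat dag-n08-b (g37) under node00-def-Y's names per the CONDITIONAL HANDOVER of
2026-08-29 (bus I.45144); def-Y's successor reviews ∕ extends by name.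
-/

noncomputable section

namespace Literature.MathematicalPhysics.QuantumFieldTheory.Balaban1983to89.Node00

open B6KLevelCensusIndexV1 (KIdx)
open B9PinMembersKLevelV1 (MemberY geo9Y bg9Y geo9Y_M)
open B9PinCarriersKLevelV1 (OperatorLayerY carriersY)
open B9PinGeometryKLevelV1 (inΛY unitDistY c35Y)
open B7Prop2SpecialUnitary (specialUnitaryUnits)
open B9Eq3132SectDLetters (QGQinvY)
open scoped Matrix

variable {d ℓ : ℕ} {hd : 1 ≤ d + 1} {hL : Odd (ℓ + 1) ∧ 1 < ℓ + 1} {b₀ b₁ : ℝ} {Mstar : ℕ}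

variable {𝔸 : Type} [NormedRing 𝔸] [NormedAlgebra ℂ 𝔸] [CompleteSpace 𝔸]

/-! ## §0 `inΛY → inΛstY`: a base block in `Λ` is a good block (`Λ` is a union of `(k+1)`-blocks) -/

section BaseGood

open B6GlobalChartV1 (PV domT toBox)
open B6MultiLevelBoxOperator (bigSide)
open B6Ineq2142KLevelV1 (lvl base baseSite iterBlockOf_baseSite)
open B5Eq118OneStroke (iterBlockOf val_iterBlockOf)
open B15DeterminingSets (embIter)
open B4Reflection242 (blk)
open B9BackgroundsKLevelV1 (blk_toBox_eq_mul blk_toBox_eq_iff)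

variable (x : MemberY d ℓ hd hL b₀ b₁ Mstar)

/-- **the unit torus is not the top of the block tower**: `k + 1 ≤ m + K` (the unit torus `T₁^{(k)}` has `L·M_h·P′ ≥ 2` sites per direction,
`sitesPerDir_k`, while at `k = m + K` it would have `2`). [cite: Balaban1984PropagatorsII, (2.1) p.224, bookkeeping] -/
theorem k_succ_le_mK : x.k + 1 ≤ x.m + x.K := by
  by_contra h
  have h0 : x.m + x.K - x.k = 0 := by have := x.hk; omega
  have e := sitesPerDir_k x 0
  have e' : (PV d ℓ x.m x.K hd hL).sitesPerDir x.k = 2 * (ℓ + 1) ^ (x.m + x.K - x.k) := rfl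
  rw [e', h0, pow_zero, mul_one] at e
  have h8 : 8 ≤ x.Mh * x.P' 0 := le_trans x.hM8 (Nat.le_mul_of_pos_right _ (by have := x.hP5 0; omega))
  have hL1 : x.Mh * x.P' 0 ≤ (ℓ + 1) * (x.Mh * x.P' 0) := Nat.le_mul_of_pos_left _ (Nat.succ_pos ℓ)
  omega

/-- same `(k+1)`-block ⇒ same quotient of the unit labels by `L`. [cite: Balaban1984PropagatorsI, (1.6) p.18, bookkeeping] -/
theorem val_div_eq_of_blockOf_eq {u y : USiteY x} (h : blockOf u = blockOf y) (μ : Fin (d + 1)) :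
    (u μ).val / (ℓ + 1) = (y μ).val / (ℓ + 1) := by
  have hu := Site.val_blockOf (P := PV d ℓ x.m x.K hd hL) (k_succ_le_mK x) u μ
  have hy := Site.val_blockOf (P := PV d ℓ x.m x.K hd hL) (k_succ_le_mK x) y μ
  have e : ((blockOf u) μ).val = ((blockOf y) μ).val := by rw [h]
  rw [hu, hy] at e
  exact e

/-- **`Λ` IS A UNION OF `(k+1)`-BLOCKS** (it is a union of big blocks `hΛblocks`, side `M_h·L^{k+1}`): two fine sites whose `k`-fold block points lie in the
same `L`-block of the unit torus are in `Λ` together. [cite: Balaban1985BackgroundPropagators, p.427 («Λ … a union of big blocks»); Balaban1984PropagatorsII, (2.1) p.224, bookkeeping] -/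
theorem mem_Λ_iff_of_blockOf_iterBlockOf_eq {z z' : Site (PV d ℓ x.m x.K hd hL) 0} (h : blockOf (iterBlockOf x.k z) = blockOf (iterBlockOf x.k z')) :
    z ∈ x.Λ ↔ z' ∈ x.Λ := by
  refine x.hΛblocks z z' ?_
  have hb : bigSide ℓ x.Mh x.k = (ℓ + 1) ^ (x.k + 1) * x.Mh := by unfold bigSide; ring
  rw [hb]
  refine blk_toBox_eq_mul x.toKIdx ((blk_toBox_eq_iff x.toKIdx _ z' z).2 fun μ => ?_)
  rw [pow_succ, ← Nat.div_div_eq_div_mul, ← Nat.div_div_eq_div_mul, ← val_iterBlockOf x.k x.hk z' μ, ← val_iterBlockOf x.k x.hk z μ]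
  exact (val_div_eq_of_blockOf_eq x h μ).symm

/-- ★ **the `L`-block of the `k`-fold block point of a site of `Λ` is GOOD** (`Λ′ ∋` that block). [cite: Balaban1985BackgroundPropagators, p.427 («Λ′ ⊂ T₁^{(k)} … a sum of unit blocks»), bookkeeping] -/
theorem goodY_iterBlockOf_of_mem_Λ {z : Site (PV d ℓ x.m x.K hd hL) 0} (hz : z ∈ x.Λ) : GoodY x (iterBlockOf x.k z) := by
  intro u hu
  refine ⟨embIter x.k u, ?_, iterBlockOf_embIter x.k x.hk u⟩
  refine (mem_Λ_iff_of_blockOf_iterBlockOf_eq x (z := embIter x.k u) (z' := z) ?_).2 hz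
  rw [iterBlockOf_embIter x.k x.hk]
  exact hu

/-- ★★ **`inΛY → inΛstY`**: a top-level index bond whose BASE block lies in `Λ` (def-Y MODULE 4's source convention `inΛY`: base = source if the source is
in `Ω_k^{(k)}`, else target) has a good source block or a good target block — the old variables are star variables.
[cite: Balaban1985BackgroundPropagators, p.428 («B = 0 on Λᶜ»); Balaban1984PropagatorsII, (2.3) p.224] -/
theorem inΛstY_of_inΛY {q : IBondY x.toKIdx} (h : inΛY x q) : inΛstY x q := by
  obtain ⟨⟨j, b⟩, hb⟩ := q
  have hj : j = Fin.last x.k := Fin.ext h.1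
  subst hj
  refine ⟨h.1, ?_⟩
  have e := iterBlockOf_baseSite x.hN x.D x.hk ⟨⟨Fin.last x.k, b⟩, hb⟩
  have hG := goodY_iterBlockOf_of_mem_Λ x h.2
  have es : usrc x ⟨⟨Fin.last x.k, b⟩, hb⟩ = b.src := iterBlockOf_embIter x.k x.hk _
  have et : utgt x ⟨⟨Fin.last x.k, b⟩, hb⟩ = b.tgt := iterBlockOf_embIter x.k x.hk _
  unfold base at e
  by_cases hs : b.src ∈ (domT x.hN x.D x.hk).Om x.k
  · have hs' : (⟨⟨Fin.last x.k, b⟩, hb⟩ : IBondY x.toKIdx).1.2.src ∈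
        (domT x.hN x.D x.hk).Om (lvl x.hN x.D x.hk ⟨⟨Fin.last x.k, b⟩, hb⟩) := hs
    rw [if_pos hs'] at e
    have e' : iterBlockOf x.k (baseSite x.hN x.D x.hk ⟨⟨Fin.last x.k, b⟩, hb⟩) = b.src := e
    left
    rw [es, ← e']
    exact hG
  · have hs' : ¬ (⟨⟨Fin.last x.k, b⟩, hb⟩ : IBondY x.toKIdx).1.2.src ∈
        (domT x.hN x.D x.hk).Om (lvl x.hN x.D x.hk ⟨⟨Fin.last x.k, b⟩, hb⟩) := hs
    rw [if_neg hs'] at e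
    have e' : iterBlockOf x.k (baseSite x.hN x.D x.hk ⟨⟨Fin.last x.k, b⟩, hb⟩) = b.tgt := e
    right
    rw [et, ← e']
    exact hG

omit [CompleteSpace 𝔸] in
/-- hence the source sector is inside the star sector: `P_Λ^st P_Λ = P_Λ`. [cite: Balaban1984PropagatorsII, (2.3) p.224, bookkeeping] -/
theorem secY_inΛstY_mul_secΛY : secY 𝔸 (inΛstY x) * secΛY 𝔸 x = secΛY 𝔸 x := secY_mul_secY_of_imp fun _ h => inΛstY_of_inΛY x h

end BaseGood

/-! ## §1 The star sector `P_Λ^st`: restriction to the bonds with at least one end block in `Λ′` -/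

section Carrier

variable (𝔸)

/-- ★ **restriction to the bonds of `Λ`, STAR CONVENTION** (`P_Λ^st`): the top-level index bonds with source block OR target block good (part 1's
`inΛstY`) — the carrier of print's `C^{(k)}(Λ)` with its Dirichlet conditions «B = 0 on Λᶜ» read as in [4] (2.3) ∕ Lemma 2.4.
[cite: Balaban1985BackgroundPropagators, p.428 («B = 0 on Λᶜ»); Balaban1984PropagatorsII, (2.3) p.224, Lemma 2.4 p.245] -/
def secΛstY (x : MemberY d ℓ hd hL b₀ b₁ Mstar) : Module.End ℂ (IBondY x.toKIdx → 𝔸) := secY 𝔸 (inΛstY x)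

variable {𝔸}

omit [CompleteSpace 𝔸] in
/-- `(P_Λ^st)² = P_Λ^st`. [cite: Balaban1985BackgroundPropagators, p.428, bookkeeping] -/
theorem secΛstY_idem (x : MemberY d ℓ hd hL b₀ b₁ Mstar) : secΛstY 𝔸 x * secΛstY 𝔸 x = secΛstY 𝔸 x := secY_idem _

omit [CompleteSpace 𝔸] in
/-- `a P_Λ^st P_Λ^st = a P_Λ^st`. [cite: Balaban1985BackgroundPropagators, p.428, bookkeeping] -/
theorem mul_secΛstY_mul_secΛstY (x : MemberY d ℓ hd hL b₀ b₁ Mstar) (a : Module.End ℂ (IBondY x.toKIdx → 𝔸)) :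
    a * secΛstY 𝔸 x * secΛstY 𝔸 x = a * secΛstY 𝔸 x := mul_secY_mul_secY _ a

omit [CompleteSpace 𝔸] in
/-- `P_Λ^st` evaluated at a star variable. [cite: Balaban1985BackgroundPropagators, p.428, bookkeeping] -/
theorem secΛstY_apply_of (x : MemberY d ℓ hd hL b₀ b₁ Mstar) {q : IBondY x.toKIdx} (h : inΛstY x q) (f : IBondY x.toKIdx → 𝔸) :
    secΛstY 𝔸 x f q = f q := secY_apply_of h f

omit [CompleteSpace 𝔸] in
/-- `P_Λ^st` evaluated off the star variables. [cite: Balaban1985BackgroundPropagators, p.428, bookkeeping] -/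
theorem secΛstY_apply_of_not (x : MemberY d ℓ hd hL b₀ b₁ Mstar) {q : IBondY x.toKIdx} (h : ¬ inΛstY x q) (f : IBondY x.toKIdx → 𝔸) :
    secΛstY 𝔸 x f q = 0 := secY_apply_of_not h f

end Carrier

/-! ## §2 The residual Sect. E letter record, STAR CONVENTION -/

section Letters

variable (𝔸)

/-- ★ **THE RESIDUAL SECT. E LETTERS AT A MEMBER, STAR CONVENTION** — `OpsYSectE.SectELettersY` with `Λ̃ ⊆` THE STAR VARIABLES (`LamT_inΛst`): `LamT` =
`Λ̃` of (3.157); `D2J U` = the operator of `B ↦ 2⟨H₁D̃⁽²⁾(B), J⟩` in (3.156) with its `U = 1` clause; `elimC ∕ elimCt` = print's `C ∕ C*`; `mu ∕ muT ∕ Dbar ∕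
DbarT` = (3.169)'s `μ(B) ∕ μ*` and (3.168)'s `D ∕ D*`; `Gt2` = `G̃₂` of (3.183)∕(3.186).
[cite: Balaban1985BackgroundPropagators, (3.156)–(3.157) p.428, (3.168)–(3.169) p.430, (3.183)–(3.186) p.432; Balaban1984PropagatorsII, (2.3) p.224] -/
structure SectELettersStY (x : MemberY d ℓ hd hL b₀ b₁ Mstar) where
  LamT : IBondY x.toKIdx → Prop
  LamT_inΛst : ∀ b, LamT b → inΛstY x b
  D2J : IBondOpY 𝔸 x.toKIdx
  D2J_one : D2J (fun _ _ => 1) = 0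
  elimC : IBondOpY 𝔸 x.toKIdx
  elimCt : IBondOpY 𝔸 x.toKIdx
  mu : CfgY 𝔸 x.toKIdx → (IBondY x.toKIdx → 𝔸) →ₗ[ℂ] (SiteY x.toKIdx → 𝔸)
  muT : CfgY 𝔸 x.toKIdx → (SiteY x.toKIdx → 𝔸) →ₗ[ℂ] (IBondY x.toKIdx → 𝔸)
  Dbar : CfgY 𝔸 x.toKIdx → (SiteY x.toKIdx → 𝔸) →ₗ[ℂ] (IBondY x.toKIdx → 𝔸)
  DbarT : CfgY 𝔸 x.toKIdx → (IBondY x.toKIdx → 𝔸) →ₗ[ℂ] (SiteY x.toKIdx → 𝔸)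
  Gt2 : BondOpY 𝔸 x.toKIdx

/-- the flat star letters (`Λ̃ :=` all star variables, every operator `0`) — inhabitation only (`CkStY_flat`). [cite: Balaban1985BackgroundPropagators, (3.156)–(3.158) p.428, bookkeeping] -/
def sectELettersStY_flat (x : MemberY d ℓ hd hL b₀ b₁ Mstar) : SectELettersStY 𝔸 x where
  LamT := inΛstY x
  LamT_inΛst := fun _ h => h
  D2J := fun _ => 0
  D2J_one := rfl
  elimC := fun _ => 0
  elimCt := fun _ => 0
  mu := fun _ => 0
  muT := fun _ => 0
  Dbar := fun _ => 0
  DbarT := fun _ => 0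
  Gt2 := fun _ => 0

variable {𝔸}

/-- **a star record from a source-convention record's SECTOR-FREE fields** (`D2J ∕ mu ∕ muT ∕ Dbar ∕ DbarT ∕ Gt2`) and a given star triple `Λ̃ ∕ C ∕ C*` — the
shape of part 3's record constructor (so a consumer holding `𝔢₀ : SectELettersY` keeps it). [cite: Balaban1985BackgroundPropagators, (3.156)–(3.157) p.428, bookkeeping] -/
def SectELettersStY.ofParams {x : MemberY d ℓ hd hL b₀ b₁ Mstar} (𝔢₀ : SectELettersY 𝔸 x) (LamT : IBondY x.toKIdx → Prop)
    (hLamT : ∀ b, LamT b → inΛstY x b) (elimC elimCt : IBondOpY 𝔸 x.toKIdx) : SectELettersStY 𝔸 x where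
  LamT := LamT
  LamT_inΛst := hLamT
  D2J := 𝔢₀.D2J
  D2J_one := 𝔢₀.D2J_one
  elimC := elimC
  elimCt := elimCt
  mu := 𝔢₀.mu
  muT := 𝔢₀.muT
  Dbar := 𝔢₀.Dbar
  DbarT := 𝔢₀.DbarT
  Gt2 := 𝔢₀.Gt2

/-- the sector-free fields of `ofParams` are `𝔢₀`'s. [cite: Balaban1985BackgroundPropagators, (3.156) p.428, bookkeeping] -/
theorem SectELettersStY.ofParams_params {x : MemberY d ℓ hd hL b₀ b₁ Mstar} (𝔢₀ : SectELettersY 𝔸 x) (LamT : IBondY x.toKIdx → Prop)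
    (hLamT : ∀ b, LamT b → inΛstY x b) (elimC elimCt : IBondOpY 𝔸 x.toKIdx) :
    (SectELettersStY.ofParams 𝔢₀ LamT hLamT elimC elimCt).D2J = 𝔢₀.D2J ∧ (SectELettersStY.ofParams 𝔢₀ LamT hLamT elimC elimCt).mu = 𝔢₀.mu ∧
      (SectELettersStY.ofParams 𝔢₀ LamT hLamT elimC elimCt).muT = 𝔢₀.muT ∧ (SectELettersStY.ofParams 𝔢₀ LamT hLamT elimC elimCt).Dbar = 𝔢₀.Dbar ∧
      (SectELettersStY.ofParams 𝔢₀ LamT hLamT elimC elimCt).DbarT = 𝔢₀.DbarT ∧ (SectELettersStY.ofParams 𝔢₀ LamT hLamT elimC elimCt).Gt2 = 𝔢₀.Gt2 :=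
  ⟨rfl, rfl, rfl, rfl, rfl, rfl⟩

/-- the star triple of `ofParams` is the given one. [cite: Balaban1985BackgroundPropagators, (3.157) p.428, bookkeeping] -/
theorem SectELettersStY.ofParams_letters {x : MemberY d ℓ hd hL b₀ b₁ Mstar} (𝔢₀ : SectELettersY 𝔸 x) (LamT : IBondY x.toKIdx → Prop)
    (hLamT : ∀ b, LamT b → inΛstY x b) (elimC elimCt : IBondOpY 𝔸 x.toKIdx) :
    (SectELettersStY.ofParams 𝔢₀ LamT hLamT elimC elimCt).LamT = LamT ∧ (SectELettersStY.ofParams 𝔢₀ LamT hLamT elimC elimCt).elimC = elimC ∧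
      (SectELettersStY.ofParams 𝔢₀ LamT hLamT elimC elimCt).elimCt = elimCt :=
  ⟨rfl, rfl, rfl⟩

/-- ★ **THE COERCION `SectELettersY → SectELettersStY`**: a source-convention record IS a star record (its `Λ̃ ⊆ inΛY ⊆ inΛstY`, §0 `inΛstY_of_inΛY`);
every field is copied verbatim. [cite: Balaban1985BackgroundPropagators, (3.156)–(3.157) p.428; Balaban1984PropagatorsII, (2.3) p.224, bookkeeping] -/
def SectELettersY.toStar {x : MemberY d ℓ hd hL b₀ b₁ Mstar} (𝔢 : SectELettersY 𝔸 x) : SectELettersStY 𝔸 x where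
  LamT := 𝔢.LamT
  LamT_inΛst := fun b h => inΛstY_of_inΛY x (𝔢.LamT_inΛ b h)
  D2J := 𝔢.D2J
  D2J_one := 𝔢.D2J_one
  elimC := 𝔢.elimC
  elimCt := 𝔢.elimCt
  mu := 𝔢.mu
  muT := 𝔢.muT
  Dbar := 𝔢.Dbar
  DbarT := 𝔢.DbarT
  Gt2 := 𝔢.Gt2

/-- the coercion copies every field. [cite: Balaban1985BackgroundPropagators, (3.156)–(3.157) p.428, bookkeeping] -/
theorem SectELettersY.toStar_fields {x : MemberY d ℓ hd hL b₀ b₁ Mstar} (𝔢 : SectELettersY 𝔸 x) :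
    𝔢.toStar.LamT = 𝔢.LamT ∧ 𝔢.toStar.D2J = 𝔢.D2J ∧ 𝔢.toStar.elimC = 𝔢.elimC ∧ 𝔢.toStar.elimCt = 𝔢.elimCt ∧ 𝔢.toStar.mu = 𝔢.mu ∧
      𝔢.toStar.muT = 𝔢.muT ∧ 𝔢.toStar.Dbar = 𝔢.Dbar ∧ 𝔢.toStar.DbarT = 𝔢.DbarT ∧ 𝔢.toStar.Gt2 = 𝔢.Gt2 :=
  ⟨rfl, rfl, rfl, rfl, rfl, rfl, rfl, rfl, rfl⟩

variable (𝔸) in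
/-- the flat source record coerces to a star record with `Λ̃ = inΛY` (NOT the flat star record, whose `Λ̃ = inΛstY`). [cite: Balaban1985BackgroundPropagators, (3.157) p.428, bookkeeping] -/
theorem sectELettersY_flat_toStar_LamT (x : MemberY d ℓ hd hL b₀ b₁ Mstar) : (sectELettersY_flat 𝔸 x).toStar.LamT = inΛY x := rfl

end Letters

/-! ## §3 The definition (3.156)–(3.158) over the star sector: `Δ_k`, `C̃^{(k)}(Λ) = (C*Δ_kC)⁻¹`, `C^{(k)}(Λ) = C C̃^{(k)}(Λ) C*` -/

section Definition

variable (x : MemberY d ℓ hd hL b₀ b₁ Mstar) (𝔏 : CovLettersY 𝔸 x) (𝔢 : SectELettersStY 𝔸 x)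

/-- ★ **(3.156)** `Δ_k(U) := (QG₁Q*)⁻¹(U) − a − D2J(U)` at a STAR letter record (the same formula as `OpsYSectE.deltaKY`; the record type differs).
[cite: Balaban1985BackgroundPropagators, (3.156) p.428] -/
def deltaKstY : IBondOpY 𝔸 x.toKIdx := fun U => 𝔏.QG1Qinv U - aY x.toKIdx - 𝔢.D2J U

/-- **`P_Λ^st C(U) P_Λ̃`** — the parametrisation `C` read from the `Λ̃`-functions to the STAR `Λ`-functions. [cite: Balaban1985BackgroundPropagators, (3.157) p.428 («B = CB̃»); Balaban1984PropagatorsII, (2.3) p.224] -/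
def elimCΛstY : IBondOpY 𝔸 x.toKIdx := fun U => secΛstY 𝔸 x * 𝔢.elimC U * secY 𝔸 𝔢.LamT

/-- **`P_Λ̃ C*(U) P_Λ^st`**. [cite: Balaban1985BackgroundPropagators, (3.157) p.428 («C*g»); Balaban1984PropagatorsII, (2.3) p.224] -/
def elimCtΛstY : IBondOpY 𝔸 x.toKIdx := fun U => secY 𝔸 𝔢.LamT * 𝔢.elimCt U * secΛstY 𝔸 x

/-- **(3.157)'s `C*Δ_kC`** on the `Λ̃`-functions, star edition. [cite: Balaban1985BackgroundPropagators, (3.157) p.428] -/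
def CsDeltaCstY : IBondOpY 𝔸 x.toKIdx := fun U => elimCtΛstY x 𝔢 U * deltaKstY x 𝔏 𝔢 U * elimCΛstY x 𝔢 U

/-- ★ **(3.158)₁ `C̃^{(k)}(Λ; U) := (C*Δ_kC)⁻¹`** on the `Λ̃`-functions (sector inverse), star edition. [cite: Balaban1985BackgroundPropagators, (3.158) p.428] -/
def CtildeKstY : IBondOpY 𝔸 x.toKIdx := fun U => secInvY 𝔸 𝔢.LamT (CsDeltaCstY x 𝔏 𝔢 U)

/-- ★★ **THE UNIT-LATTICE PROPAGATOR `C^{(k)}(Λ; U) := C C̃^{(k)}(Λ) C*`, STAR EDITION** — an operator on the `𝔸`-valued functions on the bonds with at least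
one end block in `Λ′` (Dirichlet elsewhere). [cite: Balaban1985BackgroundPropagators, (3.158) p.428, Thm 3.15 p.432; Balaban1984PropagatorsII, (2.3) p.224] -/
def CkStY : IBondOpY 𝔸 x.toKIdx := fun U => elimCΛstY x 𝔢 U * CtildeKstY x 𝔏 𝔢 U * elimCtΛstY x 𝔢 U

variable {x 𝔏 𝔢}

/-- `Δ_k` unfolded. [cite: Balaban1985BackgroundPropagators, (3.156) p.428, bookkeeping] -/
theorem deltaKstY_apply (U : CfgY 𝔸 x.toKIdx) : deltaKstY x 𝔏 𝔢 U = 𝔏.QG1Qinv U - aY x.toKIdx - 𝔢.D2J U := rfl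

/-- at `U = 1`: `Δ_k(1) = (QG₁Q*)⁻¹(1) − a`. [cite: Balaban1985BackgroundPropagators, (3.156) p.428, (3.117) p.419 (J = 0 at U = 1)] -/
theorem deltaKstY_one : deltaKstY x 𝔏 𝔢 (fun _ _ => 1) = 𝔏.QG1Qinv (fun _ _ => 1) - aY x.toKIdx := by
  rw [deltaKstY_apply, 𝔢.D2J_one, sub_zero]

variable (x) in
/-- at `U = 1` AND at def-Y's v3 letters: `Δ_k(1) = (QGQ*)⁻¹(1) − a` with n06-i's GENUINE `(QGQ*)⁻¹`. [cite: Balaban1985BackgroundPropagators, (3.156) p.428, (3.132) p.422, Cor. 3.5 p.407 (U = 1)] -/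
theorem deltaKstY_one_v3 (𝔯 : ResLettersY 𝔸 x) (𝔢 : SectELettersStY 𝔸 x) :
    deltaKstY x (covLettersY_v3 𝔸 x 𝔯) 𝔢 (fun _ _ => 1) =
      QGQinvY x.toKIdx (parSY x.toKIdx) (parBY x.toKIdx) (GpY x.toKIdx (parSY x.toKIdx)) (fun _ _ => 1) - aY x.toKIdx := by
  rw [deltaKstY_one, covLettersY_v3_QG1Qinv, QG1QinvY_one _ _ _ _ 𝔯.Δ2_one]

/-- **`Δ_k` is sector-free**: the star `Δ_k` of a star record equals `OpsYSectE.deltaKY` of any source-convention record with the same `D2J`.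
[cite: Balaban1985BackgroundPropagators, (3.156) p.428, bookkeeping] -/
theorem deltaKstY_eq_deltaKY (𝔢' : SectELettersY 𝔸 x) (h : 𝔢.D2J = 𝔢'.D2J) (U : CfgY 𝔸 x.toKIdx) : deltaKstY x 𝔏 𝔢 U = deltaKY x 𝔏 𝔢' U := by
  rw [deltaKstY_apply, deltaKY_apply, h]

/-- in particular for `ofParams`. [cite: Balaban1985BackgroundPropagators, (3.156) p.428, bookkeeping] -/
theorem deltaKstY_ofParams (𝔢₀ : SectELettersY 𝔸 x) (LamT : IBondY x.toKIdx → Prop) (hLamT : ∀ b, LamT b → inΛstY x b)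
    (elimC elimCt : IBondOpY 𝔸 x.toKIdx) (U : CfgY 𝔸 x.toKIdx) :
    deltaKstY x 𝔏 (SectELettersStY.ofParams 𝔢₀ LamT hLamT elimC elimCt) U = deltaKY x 𝔏 𝔢₀ U := rfl

/-- and for the coercion `toStar` (`rfl`). [cite: Balaban1985BackgroundPropagators, (3.156) p.428, bookkeeping] -/
theorem deltaKstY_toStar (𝔢₀ : SectELettersY 𝔸 x) (U : CfgY 𝔸 x.toKIdx) : deltaKstY x 𝔏 𝔢₀.toStar U = deltaKY x 𝔏 𝔢₀ U := rfl

/-- **the source-convention dressed letter is star-Dirichlet**: `P_Λ^st · (P_Λ C P_Λ̃) = P_Λ C P_Λ̃` (`OpsYSectE.elimCΛY` ranges in the source sector, which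
lies inside the star sector by §0). [cite: Balaban1984PropagatorsII, (2.3) p.224, bookkeeping] -/
theorem secΛstY_mul_elimCΛY (𝔢₀ : SectELettersY 𝔸 x) (U : CfgY 𝔸 x.toKIdx) : secΛstY 𝔸 x * elimCΛY x 𝔢₀ U = elimCΛY x 𝔢₀ U := by
  show secY 𝔸 (inΛstY x) * (secΛY 𝔸 x * 𝔢₀.elimC U * secY 𝔸 𝔢₀.LamT) = _
  rw [← mul_assoc, ← mul_assoc, secY_inΛstY_mul_secΛY]
  rfl

/-- `C^{(k)}(Λ)` unfolded: `C C̃^{(k)}(Λ) C*`. [cite: Balaban1985BackgroundPropagators, (3.158) p.428, bookkeeping] -/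
theorem CkStY_apply (U : CfgY 𝔸 x.toKIdx) : CkStY x 𝔏 𝔢 U = elimCΛstY x 𝔢 U * CtildeKstY x 𝔏 𝔢 U * elimCtΛstY x 𝔢 U := rfl

/-- `C*Δ_kC` unfolded. [cite: Balaban1985BackgroundPropagators, (3.157) p.428, bookkeeping] -/
theorem CsDeltaCstY_apply (U : CfgY 𝔸 x.toKIdx) : CsDeltaCstY x 𝔏 𝔢 U = elimCtΛstY x 𝔢 U * deltaKstY x 𝔏 𝔢 U * elimCΛstY x 𝔢 U := rfl

/-- `C̃^{(k)}(Λ)` unfolded. [cite: Balaban1985BackgroundPropagators, (3.158) p.428, bookkeeping] -/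
theorem CtildeKstY_apply (U : CfgY 𝔸 x.toKIdx) : CtildeKstY x 𝔏 𝔢 U = secInvY 𝔸 𝔢.LamT (CsDeltaCstY x 𝔏 𝔢 U) := rfl

/-- Dirichlet (left), star: `P_Λ^st C^{(k)}(Λ; U) = C^{(k)}(Λ; U)`. [cite: Balaban1985BackgroundPropagators, p.427 (Dirichlet outside Λ), (3.158) p.428; Balaban1984PropagatorsII, (2.3) p.224] -/
theorem secΛstY_mul_CkStY (U : CfgY 𝔸 x.toKIdx) : secΛstY 𝔸 x * CkStY x 𝔏 𝔢 U = CkStY x 𝔏 𝔢 U := by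
  simp only [CkStY, elimCΛstY, ← mul_assoc, secΛstY_idem]

/-- Dirichlet (right), star: `C^{(k)}(Λ; U) P_Λ^st = C^{(k)}(Λ; U)`. [cite: Balaban1985BackgroundPropagators, p.427, (3.158) p.428; Balaban1984PropagatorsII, (2.3) p.224] -/
theorem CkStY_mul_secΛstY (U : CfgY 𝔸 x.toKIdx) : CkStY x 𝔏 𝔢 U * secΛstY 𝔸 x = CkStY x 𝔏 𝔢 U := by
  simp only [CkStY, elimCtΛstY, ← mul_assoc, mul_secΛstY_mul_secΛstY]

/-- `P_Λ^st C P_Λ̃` unfolded at a function. [cite: Balaban1985BackgroundPropagators, (3.157) p.428, bookkeeping] -/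
theorem elimCΛstY_apply (U : CfgY 𝔸 x.toKIdx) (B : IBondY x.toKIdx → 𝔸) :
    elimCΛstY x 𝔢 U B = secΛstY 𝔸 x (𝔢.elimC U (secY 𝔸 𝔢.LamT B)) := rfl

/-- `P_Λ̃ C* P_Λ^st` unfolded at a function. [cite: Balaban1985BackgroundPropagators, (3.157) p.428, bookkeeping] -/
theorem elimCtΛstY_apply (U : CfgY 𝔸 x.toKIdx) (A : IBondY x.toKIdx → 𝔸) :
    elimCtΛstY x 𝔢 U A = secY 𝔸 𝔢.LamT (𝔢.elimCt U (secΛstY 𝔸 x A)) := rfl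

/-- the range of `P_Λ^st C P_Λ̃` lies in the star `Λ`-functions. [cite: Balaban1985BackgroundPropagators, (3.157) p.428, bookkeeping] -/
theorem secΛstY_mul_elimCΛstY (U : CfgY 𝔸 x.toKIdx) : secΛstY 𝔸 x * elimCΛstY x 𝔢 U = elimCΛstY x 𝔢 U := by
  simp only [elimCΛstY, ← mul_assoc, secΛstY_idem]

/-- `P_Λ^st C P_Λ̃` reads `Λ̃` only. [cite: Balaban1985BackgroundPropagators, (3.157) p.428, bookkeeping] -/
theorem elimCΛstY_mul_secY (U : CfgY 𝔸 x.toKIdx) : elimCΛstY x 𝔢 U * secY 𝔸 𝔢.LamT = elimCΛstY x 𝔢 U := by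
  simp only [elimCΛstY, mul_assoc, secY_idem]

/-- the range of `P_Λ̃ C* P_Λ^st` lies in the `Λ̃`-functions. [cite: Balaban1985BackgroundPropagators, (3.157) p.428, bookkeeping] -/
theorem secY_mul_elimCtΛstY (U : CfgY 𝔸 x.toKIdx) : secY 𝔸 𝔢.LamT * elimCtΛstY x 𝔢 U = elimCtΛstY x 𝔢 U := by
  simp only [elimCtΛstY, ← mul_assoc, secY_idem]

/-- `P_Λ̃ C* P_Λ^st` reads the star `Λ`-functions only. [cite: Balaban1985BackgroundPropagators, (3.157) p.428, bookkeeping] -/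
theorem elimCtΛstY_mul_secΛstY (U : CfgY 𝔸 x.toKIdx) : elimCtΛstY x 𝔢 U * secΛstY 𝔸 x = elimCtΛstY x 𝔢 U := by
  simp only [elimCtΛstY, mul_assoc, secΛstY_idem]

/-- `C̃^{(k)}(Λ)` is supported in `Λ̃` (left). [cite: Balaban1985BackgroundPropagators, (3.158) p.428] -/
theorem secY_mul_CtildeKstY (U : CfgY 𝔸 x.toKIdx) : secY 𝔸 𝔢.LamT * CtildeKstY x 𝔏 𝔢 U = CtildeKstY x 𝔏 𝔢 U := secY_mul_secInvY _ _

/-- `C̃^{(k)}(Λ)` is supported in `Λ̃` (right). [cite: Balaban1985BackgroundPropagators, (3.158) p.428] -/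
theorem CtildeKstY_mul_secY (U : CfgY 𝔸 x.toKIdx) : CtildeKstY x 𝔏 𝔢 U * secY 𝔸 𝔢.LamT = CtildeKstY x 𝔏 𝔢 U := secInvY_mul_secY _ _

/-- `C*Δ_kC` is an operator on the `Λ̃`-functions: `P_Λ̃ (C*Δ_kC) P_Λ̃ = C*Δ_kC`. [cite: Balaban1985BackgroundPropagators, (3.157) p.428, bookkeeping] -/
theorem secY_mul_CsDeltaCstY_mul_secY (U : CfgY 𝔸 x.toKIdx) :
    secY 𝔸 𝔢.LamT * CsDeltaCstY x 𝔏 𝔢 U * secY 𝔸 𝔢.LamT = CsDeltaCstY x 𝔏 𝔢 U := by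
  simp only [CsDeltaCstY, elimCtΛstY, elimCΛstY, ← mul_assoc, secY_idem, mul_secY_mul_secY]

/-- ★ **(3.158) on the `Λ̃`-functions (right inverse)**: `(C*Δ_kC)·C̃^{(k)}(Λ) = P_Λ̃` whenever the `Λ̃`-corner of `C*Δ_kC` is a unit (p. 428's positivity
«lower bound γ₀ > 0 independent of k and U» — NOT claimed here). [cite: Balaban1985BackgroundPropagators, (3.158) p.428] -/
theorem CsDeltaCstY_mul_CtildeKstY (U : CfgY 𝔸 x.toKIdx) (h : IsUnit (secCornerY 𝔸 𝔢.LamT (CsDeltaCstY x 𝔏 𝔢 U))) :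
    CsDeltaCstY x 𝔏 𝔢 U * CtildeKstY x 𝔏 𝔢 U = secY 𝔸 𝔢.LamT := by
  rw [← secY_mul_CsDeltaCstY_mul_secY U]
  exact corner_mul_secInvY _ _ h

/-- ★ **… (left inverse)**: `C̃^{(k)}(Λ)·(C*Δ_kC) = P_Λ̃`. [cite: Balaban1985BackgroundPropagators, (3.158) p.428] -/
theorem CtildeKstY_mul_CsDeltaCstY (U : CfgY 𝔸 x.toKIdx) (h : IsUnit (secCornerY 𝔸 𝔢.LamT (CsDeltaCstY x 𝔏 𝔢 U))) :
    CtildeKstY x 𝔏 𝔢 U * CsDeltaCstY x 𝔏 𝔢 U = secY 𝔸 𝔢.LamT := by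
  rw [← secY_mul_CsDeltaCstY_mul_secY U]
  exact secInvY_mul_corner _ _ h

variable (x 𝔏) in
/-- THE VACUITY GUARD: at the flat star letters (`C = 0`) the propagator letter is `0`. [cite: Balaban1985BackgroundPropagators, (3.158) p.428, bookkeeping] -/
theorem CkStY_flat (U : CfgY 𝔸 x.toKIdx) : CkStY x 𝔏 (sectELettersStY_flat 𝔸 x) U = 0 := by
  simp only [CkStY, elimCΛstY, sectELettersStY_flat, mul_zero, zero_mul]

end Definition

/-! ## §4 The print-unit star letters (`η^{d+1}`-currency of `OpsYSectEPrintUnits`, by name) -/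

section PrintLetters

variable (x : MemberY d ℓ hd hL b₀ b₁ Mstar) (𝔏 : CovLettersY 𝔸 x) (𝔢 : SectELettersStY 𝔸 x)

/-- ★ print's `Δ_k(U)` of (3.156) in print units, star record: `η^{d+1} • deltaKstY`. [cite: Balaban1985BackgroundPropagators, (3.156) p.428, (3.13) p.392, (3.16) p.393, dictionary] -/
def deltaKPstY : IBondOpY 𝔸 x.toKIdx := fun U => ((etaDY x : ℝ) : ℂ) • deltaKstY x 𝔏 𝔢 U

/-- print's `C*Δ_kC` of (3.157) in print units, star edition: `η^{d+1} • CsDeltaCstY`. [cite: Balaban1985BackgroundPropagators, (3.157) p.428, dictionary] -/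
def CsDeltaCPstY : IBondOpY 𝔸 x.toKIdx := fun U => ((etaDY x : ℝ) : ℂ) • CsDeltaCstY x 𝔏 𝔢 U

/-- ★ print's `C̃^{(k)}(Λ; U)` of (3.158) in print units, star edition: `η^{−(d+1)} • CtildeKstY`. [cite: Balaban1985BackgroundPropagators, (3.158) p.428, dictionary] -/
def CtildeKPstY : IBondOpY 𝔸 x.toKIdx := fun U => (((etaDY x : ℝ) : ℂ))⁻¹ • CtildeKstY x 𝔏 𝔢 U

/-- ★★ print's `C^{(k)}(Λ; U)` of (3.158) in print units, star edition: `η^{−(d+1)} • CkStY`. [cite: Balaban1985BackgroundPropagators, (3.158) p.428, Thm 3.15 p.432, dictionary] -/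
def CkPstY : IBondOpY 𝔸 x.toKIdx := fun U => (((etaDY x : ℝ) : ℂ))⁻¹ • CkStY x 𝔏 𝔢 U

variable {x 𝔏 𝔢}

/-- `η^{d+1}Δ_k` unfolded. [cite: Balaban1985BackgroundPropagators, (3.156) p.428, bookkeeping] -/
theorem deltaKPstY_apply (U : CfgY 𝔸 x.toKIdx) : deltaKPstY x 𝔏 𝔢 U = ((etaDY x : ℝ) : ℂ) • deltaKstY x 𝔏 𝔢 U := rfl

/-- `η^{d+1}C*Δ_kC` unfolded. [cite: Balaban1985BackgroundPropagators, (3.157) p.428, bookkeeping] -/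
theorem CsDeltaCPstY_apply (U : CfgY 𝔸 x.toKIdx) : CsDeltaCPstY x 𝔏 𝔢 U = ((etaDY x : ℝ) : ℂ) • CsDeltaCstY x 𝔏 𝔢 U := rfl

/-- `η^{−(d+1)}C̃^{(k)}(Λ)` unfolded. [cite: Balaban1985BackgroundPropagators, (3.158) p.428, bookkeeping] -/
theorem CtildeKPstY_apply (U : CfgY 𝔸 x.toKIdx) : CtildeKPstY x 𝔏 𝔢 U = (((etaDY x : ℝ) : ℂ))⁻¹ • CtildeKstY x 𝔏 𝔢 U := rfl

/-- `η^{−(d+1)}C^{(k)}(Λ)` unfolded. [cite: Balaban1985BackgroundPropagators, (3.158) p.428, bookkeeping] -/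
theorem CkPstY_apply (U : CfgY 𝔸 x.toKIdx) : CkPstY x 𝔏 𝔢 U = (((etaDY x : ℝ) : ℂ))⁻¹ • CkStY x 𝔏 𝔢 U := rfl

/-- entry level: `(η^{d+1}Δ_k B)(c) = η^{d+1}·(Δ_k B)(c)`. [cite: Balaban1985BackgroundPropagators, (3.156) p.428, bookkeeping] -/
theorem deltaKPstY_apply_apply (U : CfgY 𝔸 x.toKIdx) (B : IBondY x.toKIdx → 𝔸) (c : IBondY x.toKIdx) :
    deltaKPstY x 𝔏 𝔢 U B c = ((etaDY x : ℝ) : ℂ) • deltaKstY x 𝔏 𝔢 U B c := rfl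

/-- entry level for `η^{d+1}C*Δ_kC`. [cite: Balaban1985BackgroundPropagators, (3.157) p.428, bookkeeping] -/
theorem CsDeltaCPstY_apply_apply (U : CfgY 𝔸 x.toKIdx) (B : IBondY x.toKIdx → 𝔸) (c : IBondY x.toKIdx) :
    CsDeltaCPstY x 𝔏 𝔢 U B c = ((etaDY x : ℝ) : ℂ) • CsDeltaCstY x 𝔏 𝔢 U B c := rfl

/-- entry level for `η^{−(d+1)}C̃^{(k)}(Λ)`. [cite: Balaban1985BackgroundPropagators, (3.158) p.428, bookkeeping] -/
theorem CtildeKPstY_apply_apply (U : CfgY 𝔸 x.toKIdx) (B : IBondY x.toKIdx → 𝔸) (c : IBondY x.toKIdx) :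
    CtildeKPstY x 𝔏 𝔢 U B c = (((etaDY x : ℝ) : ℂ))⁻¹ • CtildeKstY x 𝔏 𝔢 U B c := rfl

/-- entry level for `η^{−(d+1)}C^{(k)}(Λ)`. [cite: Balaban1985BackgroundPropagators, (3.158) p.428, bookkeeping] -/
theorem CkPstY_apply_apply (U : CfgY 𝔸 x.toKIdx) (B : IBondY x.toKIdx → 𝔸) (c : IBondY x.toKIdx) :
    CkPstY x 𝔏 𝔢 U B c = (((etaDY x : ℝ) : ℂ))⁻¹ • CkStY x 𝔏 𝔢 U B c := rfl

/-- ★ norm dictionary: `‖(η^{d+1}Δ_k B)(c)‖ = η^{d+1}·‖(Δ_k B)(c)‖`. [cite: Balaban1985BackgroundPropagators, (3.156) p.428, (3.13) p.392, bookkeeping] -/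
theorem norm_deltaKPstY_apply (U : CfgY 𝔸 x.toKIdx) (B : IBondY x.toKIdx → 𝔸) (c : IBondY x.toKIdx) :
    ‖deltaKPstY x 𝔏 𝔢 U B c‖ = etaDY x * ‖deltaKstY x 𝔏 𝔢 U B c‖ := by
  rw [deltaKPstY_apply_apply, norm_smul, norm_etaDY_coe]

/-- `‖(η^{d+1}C*Δ_kC B)(c)‖ = η^{d+1}·‖(C*Δ_kC B)(c)‖`. [cite: Balaban1985BackgroundPropagators, (3.157) p.428, bookkeeping] -/
theorem norm_CsDeltaCPstY_apply (U : CfgY 𝔸 x.toKIdx) (B : IBondY x.toKIdx → 𝔸) (c : IBondY x.toKIdx) :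
    ‖CsDeltaCPstY x 𝔏 𝔢 U B c‖ = etaDY x * ‖CsDeltaCstY x 𝔏 𝔢 U B c‖ := by
  rw [CsDeltaCPstY_apply_apply, norm_smul, norm_etaDY_coe]

/-- ★ `‖(η^{−(d+1)}C̃^{(k)} B)(c)‖ = η^{−(d+1)}·‖(C̃^{(k)} B)(c)‖`. [cite: Balaban1985BackgroundPropagators, (3.158) p.428, bookkeeping] -/
theorem norm_CtildeKPstY_apply (U : CfgY 𝔸 x.toKIdx) (B : IBondY x.toKIdx → 𝔸) (c : IBondY x.toKIdx) :
    ‖CtildeKPstY x 𝔏 𝔢 U B c‖ = (etaDY x)⁻¹ * ‖CtildeKstY x 𝔏 𝔢 U B c‖ := by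
  rw [CtildeKPstY_apply_apply, norm_smul, norm_etaDY_coe_inv]

/-- ★ `‖(η^{−(d+1)}C^{(k)} B)(c)‖ = η^{−(d+1)}·‖(C^{(k)} B)(c)‖`. [cite: Balaban1985BackgroundPropagators, (3.158) p.428, (3.187) p.432, bookkeeping] -/
theorem norm_CkPstY_apply (U : CfgY 𝔸 x.toKIdx) (B : IBondY x.toKIdx → 𝔸) (c : IBondY x.toKIdx) :
    ‖CkPstY x 𝔏 𝔢 U B c‖ = (etaDY x)⁻¹ * ‖CkStY x 𝔏 𝔢 U B c‖ := by
  rw [CkPstY_apply_apply, norm_smul, norm_etaDY_coe_inv]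

/-- the converse reading: `‖(Δ_k B)(c)‖ = η^{−(d+1)}·‖(η^{d+1}Δ_k B)(c)‖`. [cite: Balaban1985BackgroundPropagators, (3.156) p.428, bookkeeping] -/
theorem norm_deltaKstY_apply_eq (U : CfgY 𝔸 x.toKIdx) (B : IBondY x.toKIdx → 𝔸) (c : IBondY x.toKIdx) :
    ‖deltaKstY x 𝔏 𝔢 U B c‖ = (etaDY x)⁻¹ * ‖deltaKPstY x 𝔏 𝔢 U B c‖ := by
  rw [norm_deltaKPstY_apply, ← mul_assoc, etaDY_inv_mul, one_mul]

/-- the converse reading for `C^{(k)}`. [cite: Balaban1985BackgroundPropagators, (3.158) p.428, bookkeeping] -/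
theorem norm_CkStY_apply_eq (U : CfgY 𝔸 x.toKIdx) (B : IBondY x.toKIdx → 𝔸) (c : IBondY x.toKIdx) :
    ‖CkStY x 𝔏 𝔢 U B c‖ = etaDY x * ‖CkPstY x 𝔏 𝔢 U B c‖ := by
  rw [norm_CkPstY_apply, ← mul_assoc, etaDY_mul_inv, one_mul]

/-- ★ **(3.156) in print units, term by term**: `η^{d+1}Δ_k(U) = η^{d+1}(QG₁Q*)⁻¹(U) − η^{d+1}a − η^{d+1}D2J(U)`. [cite: Balaban1985BackgroundPropagators, (3.156) p.428, bookkeeping] -/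
theorem deltaKPstY_eq_sub (U : CfgY 𝔸 x.toKIdx) :
    deltaKPstY x 𝔏 𝔢 U = ((etaDY x : ℝ) : ℂ) • 𝔏.QG1Qinv U - ((etaDY x : ℝ) : ℂ) • aY x.toKIdx - ((etaDY x : ℝ) : ℂ) • 𝔢.D2J U := by
  rw [deltaKPstY_apply, deltaKstY_apply, smul_sub, smul_sub]

/-- at `U = 1`: `η^{d+1}Δ_k(1) = η^{d+1}(QG₁Q*)⁻¹(1) − η^{d+1}a`. [cite: Balaban1985BackgroundPropagators, (3.156) p.428, (3.117) p.419 (J = 0 at U = 1), bookkeeping] -/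
theorem deltaKPstY_one :
    deltaKPstY x 𝔏 𝔢 (fun _ _ => 1) = ((etaDY x : ℝ) : ℂ) • 𝔏.QG1Qinv (fun _ _ => 1) - ((etaDY x : ℝ) : ℂ) • aY x.toKIdx := by
  rw [deltaKPstY_apply, deltaKstY_one, smul_sub]

/-- **`η^{d+1}Δ_k` is sector-free**: the print-unit star `Δ_k` equals def-Y's `deltaKPY` of any source-convention record with the same `D2J`.
[cite: Balaban1985BackgroundPropagators, (3.156) p.428, bookkeeping] -/
theorem deltaKPstY_eq_deltaKPY (𝔢' : SectELettersY 𝔸 x) (h : 𝔢.D2J = 𝔢'.D2J) (U : CfgY 𝔸 x.toKIdx) : deltaKPstY x 𝔏 𝔢 U = deltaKPY x 𝔏 𝔢' U := by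
  rw [deltaKPstY_apply, deltaKPY_apply, deltaKstY_eq_deltaKY 𝔢' h]

/-- in particular for `ofParams` (`rfl`). [cite: Balaban1985BackgroundPropagators, (3.156) p.428, bookkeeping] -/
theorem deltaKPstY_ofParams (𝔢₀ : SectELettersY 𝔸 x) (LamT : IBondY x.toKIdx → Prop) (hLamT : ∀ b, LamT b → inΛstY x b)
    (elimC elimCt : IBondOpY 𝔸 x.toKIdx) (U : CfgY 𝔸 x.toKIdx) :
    deltaKPstY x 𝔏 (SectELettersStY.ofParams 𝔢₀ LamT hLamT elimC elimCt) U = deltaKPY x 𝔏 𝔢₀ U := rfl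

/-- and for the coercion `toStar` (`rfl`). [cite: Balaban1985BackgroundPropagators, (3.156) p.428, bookkeeping] -/
theorem deltaKPstY_toStar (𝔢₀ : SectELettersY 𝔸 x) (U : CfgY 𝔸 x.toKIdx) : deltaKPstY x 𝔏 𝔢₀.toStar U = deltaKPY x 𝔏 𝔢₀ U := rfl

/-- ★ **(3.157) in print units**: `η^{d+1}C*Δ_kC = C*·(η^{d+1}Δ_k)·C`. [cite: Balaban1985BackgroundPropagators, (3.157) p.428, bookkeeping] -/
theorem CsDeltaCPstY_eq (U : CfgY 𝔸 x.toKIdx) : CsDeltaCPstY x 𝔏 𝔢 U = elimCtΛstY x 𝔢 U * deltaKPstY x 𝔏 𝔢 U * elimCΛstY x 𝔢 U := by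
  rw [CsDeltaCPstY_apply, deltaKPstY_apply, CsDeltaCstY, mul_smul_comm, smul_mul_assoc]

/-- ★ **(3.158)₂ in print units**: `η^{−(d+1)}C^{(k)}(Λ) = C·(η^{−(d+1)}C̃^{(k)}(Λ))·C*`. [cite: Balaban1985BackgroundPropagators, (3.158) p.428, bookkeeping] -/
theorem CkPstY_eq (U : CfgY 𝔸 x.toKIdx) : CkPstY x 𝔏 𝔢 U = elimCΛstY x 𝔢 U * CtildeKPstY x 𝔏 𝔢 U * elimCtΛstY x 𝔢 U := by
  rw [CkPstY_apply, CtildeKPstY_apply, CkStY_apply, mul_smul_comm, smul_mul_assoc]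

/-- ★★ **(3.158)₁ in print units**: `η^{−(d+1)}C̃^{(k)}(Λ; U) = (η^{d+1}C*Δ_kC)⁻¹` on the `Λ̃`-functions. [cite: Balaban1985BackgroundPropagators, (3.158) p.428] -/
theorem CtildeKPstY_eq_secInvY (U : CfgY 𝔸 x.toKIdx) : CtildeKPstY x 𝔏 𝔢 U = secInvY 𝔸 𝔢.LamT (CsDeltaCPstY x 𝔏 𝔢 U) := by
  rw [CtildeKPstY_apply, CsDeltaCPstY_apply, secInvY_smul _ (etaDY_coe_ne_zero x), CtildeKstY]

/-- the print-unit precision's `Λ̃`-corner is a unit iff the flat one is. [cite: Balaban1985BackgroundPropagators, (3.158) p.428, bookkeeping] -/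
theorem isUnit_secCornerY_CsDeltaCPstY_iff (U : CfgY 𝔸 x.toKIdx) :
    IsUnit (secCornerY 𝔸 𝔢.LamT (CsDeltaCPstY x 𝔏 𝔢 U)) ↔ IsUnit (secCornerY 𝔸 𝔢.LamT (CsDeltaCstY x 𝔏 𝔢 U)) :=
  isUnit_secCornerY_smul_iff _ (etaDY_coe_ne_zero x) _

/-- ★ (3.158) in print units (right inverse): `(η^{d+1}C*Δ_kC)·(η^{−(d+1)}C̃^{(k)}) = P_Λ̃` under the unit hypothesis. [cite: Balaban1985BackgroundPropagators, (3.158) p.428] -/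
theorem CsDeltaCPstY_mul_CtildeKPstY (U : CfgY 𝔸 x.toKIdx) (h : IsUnit (secCornerY 𝔸 𝔢.LamT (CsDeltaCstY x 𝔏 𝔢 U))) :
    CsDeltaCPstY x 𝔏 𝔢 U * CtildeKPstY x 𝔏 𝔢 U = secY 𝔸 𝔢.LamT := by
  rw [CsDeltaCPstY_apply, CtildeKPstY_apply, smul_mul_assoc, mul_smul_comm, smul_smul, mul_inv_cancel₀ (etaDY_coe_ne_zero x), one_smul,
    CsDeltaCstY_mul_CtildeKstY U h]

/-- ★ … (left inverse). [cite: Balaban1985BackgroundPropagators, (3.158) p.428] -/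
theorem CtildeKPstY_mul_CsDeltaCPstY (U : CfgY 𝔸 x.toKIdx) (h : IsUnit (secCornerY 𝔸 𝔢.LamT (CsDeltaCstY x 𝔏 𝔢 U))) :
    CtildeKPstY x 𝔏 𝔢 U * CsDeltaCPstY x 𝔏 𝔢 U = secY 𝔸 𝔢.LamT := by
  rw [CsDeltaCPstY_apply, CtildeKPstY_apply, smul_mul_assoc, mul_smul_comm, smul_smul, inv_mul_cancel₀ (etaDY_coe_ne_zero x), one_smul,
    CtildeKstY_mul_CsDeltaCstY U h]

/-- Dirichlet (left) in print units. [cite: Balaban1985BackgroundPropagators, p.427, (3.158) p.428] -/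
theorem secΛstY_mul_CkPstY (U : CfgY 𝔸 x.toKIdx) : secΛstY 𝔸 x * CkPstY x 𝔏 𝔢 U = CkPstY x 𝔏 𝔢 U := by
  rw [CkPstY_apply, mul_smul_comm, secΛstY_mul_CkStY]

/-- Dirichlet (right) in print units. [cite: Balaban1985BackgroundPropagators, p.427, (3.158) p.428] -/
theorem CkPstY_mul_secΛstY (U : CfgY 𝔸 x.toKIdx) : CkPstY x 𝔏 𝔢 U * secΛstY 𝔸 x = CkPstY x 𝔏 𝔢 U := by
  rw [CkPstY_apply, smul_mul_assoc, CkStY_mul_secΛstY]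

/-- `η^{−(d+1)}C̃^{(k)}(Λ)` is supported in `Λ̃` (left). [cite: Balaban1985BackgroundPropagators, (3.158) p.428] -/
theorem secY_mul_CtildeKPstY (U : CfgY 𝔸 x.toKIdx) : secY 𝔸 𝔢.LamT * CtildeKPstY x 𝔏 𝔢 U = CtildeKPstY x 𝔏 𝔢 U := by
  rw [CtildeKPstY_apply, mul_smul_comm, secY_mul_CtildeKstY]

/-- `η^{−(d+1)}C̃^{(k)}(Λ)` is supported in `Λ̃` (right). [cite: Balaban1985BackgroundPropagators, (3.158) p.428] -/
theorem CtildeKPstY_mul_secY (U : CfgY 𝔸 x.toKIdx) : CtildeKPstY x 𝔏 𝔢 U * secY 𝔸 𝔢.LamT = CtildeKPstY x 𝔏 𝔢 U := by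
  rw [CtildeKPstY_apply, smul_mul_assoc, CtildeKstY_mul_secY]

/-- `η^{d+1}C*Δ_kC` is an operator on the `Λ̃`-functions. [cite: Balaban1985BackgroundPropagators, (3.157) p.428, bookkeeping] -/
theorem secY_mul_CsDeltaCPstY_mul_secY (U : CfgY 𝔸 x.toKIdx) :
    secY 𝔸 𝔢.LamT * CsDeltaCPstY x 𝔏 𝔢 U * secY 𝔸 𝔢.LamT = CsDeltaCPstY x 𝔏 𝔢 U := by
  rw [CsDeltaCPstY_apply, mul_smul_comm, smul_mul_assoc, secY_mul_CsDeltaCstY_mul_secY]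

/-- the flat letters recovered: `Δ_k^{flat} = η^{−(d+1)} • (η^{d+1}Δ_k)`. [cite: Balaban1985BackgroundPropagators, (3.156) p.428, bookkeeping] -/
theorem deltaKstY_eq_smul_deltaKPstY (U : CfgY 𝔸 x.toKIdx) : deltaKstY x 𝔏 𝔢 U = (((etaDY x : ℝ) : ℂ))⁻¹ • deltaKPstY x 𝔏 𝔢 U := by
  rw [deltaKPstY_apply, smul_smul, inv_mul_cancel₀ (etaDY_coe_ne_zero x), one_smul]

/-- the flat propagator recovered. [cite: Balaban1985BackgroundPropagators, (3.158) p.428, bookkeeping] -/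
theorem CkStY_eq_smul_CkPstY (U : CfgY 𝔸 x.toKIdx) : CkStY x 𝔏 𝔢 U = ((etaDY x : ℝ) : ℂ) • CkPstY x 𝔏 𝔢 U := by
  rw [CkPstY_apply, smul_smul, mul_inv_cancel₀ (etaDY_coe_ne_zero x), one_smul]

end PrintLetters

/-! ## §5 The representation (3.185) and the slot «C^{(k)}(Λ) is given by the formula (3.185)», star sector -/

section Representation

variable (x : MemberY d ℓ hd hL b₀ b₁ Mstar) (𝔏 : CovLettersY 𝔸 x) (𝔢 : SectELettersStY 𝔸 x)

/-- ★ **THE RIGHT-HAND SIDE OF (3.185)** `(I + Dμ)QG̃₂Q*(I + μ*D*)` on the functions on the STAR bonds of `Λ`: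
`P_Λ^st(1 + Dμ)P_Λ^st · Q(U)G̃₂(U)Q*(U) · P_Λ^st(1 + μ*D*)P_Λ^st`. [cite: Balaban1985BackgroundPropagators, (3.185) p.432, (3.15)–(3.16) p.393 (Q, Q*); Balaban1984PropagatorsII, (2.3) p.224] -/
def rhs3185stY : IBondOpY 𝔸 x.toKIdx := fun U =>
  secΛstY 𝔸 x * (1 + 𝔢.Dbar U ∘ₗ 𝔢.mu U) * secΛstY 𝔸 x *
    (QY x.toKIdx 𝔏.parB U ∘ₗ 𝔢.Gt2 U ∘ₗ QsY x.toKIdx 𝔏.parB U) *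
    (secΛstY 𝔸 x * (1 + 𝔢.muT U ∘ₗ 𝔢.DbarT U) * secΛstY 𝔸 x)

/-- ★★ **THE SLOT `GivenBy3185`, PINNED, star edition**: `C^{(k)}(Λ; U)` DEFINED by (3.156)–(3.158) EQUALS the (3.185) expression.
[cite: Balaban1985BackgroundPropagators, Thm 3.15 p.432 («is given by the formula (3.185)»), (3.158) p.428] -/
def givenBy3185stY : CfgY 𝔸 x.toKIdx → Prop := fun U => CkStY x 𝔏 𝔢 U = rhs3185stY x 𝔏 𝔢 U

variable {x 𝔏 𝔢}

/-- the slot unfolded. [cite: Balaban1985BackgroundPropagators, Thm 3.15 p.432, bookkeeping] -/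
theorem givenBy3185stY_iff (U : CfgY 𝔸 x.toKIdx) : givenBy3185stY x 𝔏 𝔢 U ↔ CkStY x 𝔏 𝔢 U = rhs3185stY x 𝔏 𝔢 U := Iff.rfl

/-- Dirichlet (left) for the (3.185) expression. [cite: Balaban1985BackgroundPropagators, (3.185) p.432, p.427] -/
theorem secΛstY_mul_rhs3185stY (U : CfgY 𝔸 x.toKIdx) : secΛstY 𝔸 x * rhs3185stY x 𝔏 𝔢 U = rhs3185stY x 𝔏 𝔢 U := by
  simp only [rhs3185stY, ← mul_assoc, secΛstY_idem]

/-- Dirichlet (right) for the (3.185) expression. [cite: Balaban1985BackgroundPropagators, (3.185) p.432, p.427] -/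
theorem rhs3185stY_mul_secΛstY (U : CfgY 𝔸 x.toKIdx) : rhs3185stY x 𝔏 𝔢 U * secΛstY 𝔸 x = rhs3185stY x 𝔏 𝔢 U := by
  simp only [rhs3185stY, ← mul_assoc, mul_secΛstY_mul_secΛstY]

variable (x 𝔏) in
/-- vacuity guard for the slot: at the flat star letters both sides of (3.185) are `0`. [cite: Balaban1985BackgroundPropagators, (3.185) p.432, bookkeeping] -/
theorem givenBy3185stY_flat (U : CfgY 𝔸 x.toKIdx) : givenBy3185stY x 𝔏 (sectELettersStY_flat 𝔸 x) U := by
  rw [givenBy3185stY_iff, CkStY_flat]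
  simp only [rhs3185stY, sectELettersStY_flat, LinearMap.comp_zero, LinearMap.zero_comp, mul_zero, zero_mul]

end Representation

/-! ## §6 The layer update: `Ck`, `GivenBy3185`, `HasRWExpC` at a member, star edition -/

section Layer

variable (𝔸) (G : Subgroup 𝔸ˣ)

/-- ★★ **THE OPERATOR LAYER WITH THE STAR SECT. E LETTER AND THE THM 3.15 SLOTS PINNED**: the base layer `ops` with `Ck :=` FILE 1's index-bond kernel reading
of `C^{(k)}(Λ; U) = CkStY x 𝔏 𝔢`, `GivenBy3185 := givenBy3185stY x 𝔏 𝔢`, `HasRWExpC := hasRWExpCY 𝔴` (`OpsYSectE`'s walk slot, unchanged); every other field is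
`ops`'s. [cite: Balaban1985BackgroundPropagators, Thm 3.15 (3.185)–(3.187) p.432, (3.158) p.428] -/
def operatorLayerYSectESt (x : MemberY d ℓ hd hL b₀ b₁ Mstar) (ops : OperatorLayerY d ℓ hd hL b₀ b₁ Mstar 𝔸 G x) (𝔏 : CovLettersY 𝔸 x)
    (𝔢 : SectELettersStY 𝔸 x) (𝔴 : RWLettersEY 𝔸 G x) : OperatorLayerY d ℓ hd hL b₀ b₁ Mstar 𝔸 G x :=
  { ops with
    Ck := siteKernelOfOp x.toKIdx (bg9Y 𝔸 G x) (fun U => U) (CkStY x 𝔏 𝔢) id id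
    GivenBy3185 := givenBy3185stY x 𝔏 𝔢
    HasRWExpC := hasRWExpCY 𝔴 }

variable {𝔸 G} {x : MemberY d ℓ hd hL b₀ b₁ Mstar} (ops : OperatorLayerY d ℓ hd hL b₀ b₁ Mstar 𝔸 G x) (𝔏 : CovLettersY 𝔸 x)
  (𝔢 : SectELettersStY 𝔸 x) (𝔴 : RWLettersEY 𝔸 G x)

/-- ★ `Ck` IS the index-bond kernel reading of the star `C^{(k)}(Λ; ·)`. [cite: Balaban1985BackgroundPropagators, Thm 3.15 (3.187) p.432, bookkeeping] -/
theorem operatorLayerYSectESt_Ck :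
    (operatorLayerYSectESt 𝔸 G x ops 𝔏 𝔢 𝔴).Ck = siteKernelOfOp x.toKIdx (bg9Y 𝔸 G x) (fun U => U) (CkStY x 𝔏 𝔢) id id := rfl
/-- ★ the kernel entry: `|C^{(k)}(Λ; U; y, y′)| = sup_E ‖(C^{(k)}(Λ; U)(δ_{y′} ⊗ E))(y)‖`. [cite: Balaban1985BackgroundPropagators, Thm 3.15 (3.187) p.432, bookkeeping] -/
theorem operatorLayerYSectESt_Ck_ker (U : (bg9Y 𝔸 G x).Cfg) (y y' : (geo9Y x).Site) :
    (operatorLayerYSectESt 𝔸 G x ops 𝔏 𝔢 𝔴).Ck.ker U y y' = ⨆ E : BallY 𝔸, ‖CkStY x 𝔏 𝔢 U (deltaY y' (E : 𝔸)) y‖ := rfl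
/-- ★ `GivenBy3185` IS the pinned (3.185) slot (star). [cite: Balaban1985BackgroundPropagators, Thm 3.15 (3.185) p.432, bookkeeping] -/
theorem operatorLayerYSectESt_GivenBy3185 : (operatorLayerYSectESt 𝔸 G x ops 𝔏 𝔢 𝔴).GivenBy3185 = givenBy3185stY x 𝔏 𝔢 := rfl
/-- ★ `HasRWExpC` IS the pinned expansion slot (unchanged). [cite: Balaban1985BackgroundPropagators, Thm 3.15 p.432, bookkeeping] -/
theorem operatorLayerYSectESt_HasRWExpC : (operatorLayerYSectESt 𝔸 G x ops 𝔏 𝔢 𝔴).HasRWExpC = hasRWExpCY 𝔴 := rfl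
/-- unchanged: `Gp`. [cite: Balaban1985BackgroundPropagators, Thm 3.1 p.397, bookkeeping] -/
theorem operatorLayerYSectESt_Gp : (operatorLayerYSectESt 𝔸 G x ops 𝔏 𝔢 𝔴).Gp = ops.Gp := rfl
/-- unchanged: `GA`. [cite: Balaban1985BackgroundPropagators, Thm 3.3 p.399, bookkeeping] -/
theorem operatorLayerYSectESt_GA : (operatorLayerYSectESt 𝔸 G x ops 𝔏 𝔢 𝔴).GA = ops.GA := rfl
/-- unchanged: `Cinv`. [cite: Balaban1985BackgroundPropagators, Thm 3.2 p.398, bookkeeping] -/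
theorem operatorLayerYSectESt_Cinv : (operatorLayerYSectESt 𝔸 G x ops 𝔏 𝔢 𝔴).Cinv = ops.Cinv := rfl
/-- unchanged: `IsAnalyticExt`. [cite: Balaban1985BackgroundPropagators, (3.37) p.396, bookkeeping] -/
theorem operatorLayerYSectESt_IsAnalyticExt : (operatorLayerYSectESt 𝔸 G x ops 𝔏 𝔢 𝔴).IsAnalyticExt = ops.IsAnalyticExt := rfl
/-- unchanged: `E37`. [cite: Balaban1985BackgroundPropagators, Thm 3.7 p.409, bookkeeping] -/
theorem operatorLayerYSectESt_E37 : (operatorLayerYSectESt 𝔸 G x ops 𝔏 𝔢 𝔴).E37 = ops.E37 := rfl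
/-- unchanged: `EK39`. [cite: Balaban1985BackgroundPropagators, Thm 3.9 p.413, bookkeeping] -/
theorem operatorLayerYSectESt_EK39 : (operatorLayerYSectESt 𝔸 G x ops 𝔏 𝔢 𝔴).EK39 = ops.EK39 := rfl
/-- unchanged: `E310`. [cite: Balaban1985BackgroundPropagators, Thm 3.10 p.415, bookkeeping] -/
theorem operatorLayerYSectESt_E310 : (operatorLayerYSectESt 𝔸 G x ops 𝔏 𝔢 𝔴).E310 = ops.E310 := rfl
/-- unchanged: `PosDef`. [cite: Balaban1985BackgroundPropagators, Thm 3.11 p.417, bookkeeping] -/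
theorem operatorLayerYSectESt_PosDef : (operatorLayerYSectESt 𝔸 G x ops 𝔏 𝔢 𝔴).PosDef = ops.PosDef := rfl
/-- unchanged: `GD`. [cite: Balaban1985BackgroundPropagators, (3.122) p.420, bookkeeping] -/
theorem operatorLayerYSectESt_GD : (operatorLayerYSectESt 𝔸 G x ops 𝔏 𝔢 𝔴).GD = ops.GD := rfl
/-- unchanged: `G₁`. [cite: Balaban1985BackgroundPropagators, (3.128) p.421, bookkeeping] -/
theorem operatorLayerYSectESt_G₁ : (operatorLayerYSectESt 𝔸 G x ops 𝔏 𝔢 𝔴).G₁ = ops.G₁ := rfl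
/-- unchanged: `H`. [cite: Balaban1985BackgroundPropagators, (3.126) p.421, bookkeeping] -/
theorem operatorLayerYSectESt_H : (operatorLayerYSectESt 𝔸 G x ops 𝔏 𝔢 𝔴).H = ops.H := rfl
/-- unchanged: `H₁`. [cite: Balaban1985BackgroundPropagators, (3.129) p.421, bookkeeping] -/
theorem operatorLayerYSectESt_H₁ : (operatorLayerYSectESt 𝔸 G x ops 𝔏 𝔢 𝔴).H₁ = ops.H₁ := rfl
/-- unchanged: `HasRWExp`. [cite: Balaban1985BackgroundPropagators, Thm 3.12 p.423, bookkeeping] -/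
theorem operatorLayerYSectESt_HasRWExp : (operatorLayerYSectESt 𝔸 G x ops 𝔏 𝔢 𝔴).HasRWExp = ops.HasRWExp := rfl
/-- unchanged: `HasRWExpH`. [cite: Balaban1985BackgroundPropagators, Thm 3.12 p.423, bookkeeping] -/
theorem operatorLayerYSectESt_HasRWExpH : (operatorLayerYSectESt 𝔸 G x ops 𝔏 𝔢 𝔴).HasRWExpH = ops.HasRWExpH := rfl
/-- unchanged: `PosDefK`. [cite: Balaban1985BackgroundPropagators, Thm 3.13 p.426, bookkeeping] -/
theorem operatorLayerYSectESt_PosDefK : (operatorLayerYSectESt 𝔸 G x ops 𝔏 𝔢 𝔴).PosDefK = ops.PosDefK := rfl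
/-- unchanged: `GG`. [cite: Balaban1985BackgroundPropagators, (3.153) p.426, bookkeeping] -/
theorem operatorLayerYSectESt_GG : (operatorLayerYSectESt 𝔸 G x ops 𝔏 𝔢 𝔴).GG = ops.GG := rfl
/-- unchanged: `Kdiff`. [cite: Balaban1985BackgroundPropagators, Thm 3.14 p.426, bookkeeping] -/
theorem operatorLayerYSectESt_Kdiff : (operatorLayerYSectESt 𝔸 G x ops 𝔏 𝔢 𝔴).Kdiff = ops.Kdiff := rfl
/-- unchanged: `P349`. [cite: Balaban1985BackgroundPropagators, (3.49) p.399, bookkeeping] -/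
theorem operatorLayerYSectESt_P349 : (operatorLayerYSectESt 𝔸 G x ops 𝔏 𝔢 𝔴).P349 = ops.P349 := rfl
/-- unchanged: `QGQinv`. [cite: Balaban1985BackgroundPropagators, (3.132) p.422, bookkeeping] -/
theorem operatorLayerYSectESt_QGQinv : (operatorLayerYSectESt 𝔸 G x ops 𝔏 𝔢 𝔴).QGQinv = ops.QGQinv := rfl
/-- unchanged: `QG1Qinv`. [cite: Balaban1985BackgroundPropagators, (3.132) p.422, bookkeeping] -/
theorem operatorLayerYSectESt_QG1Qinv : (operatorLayerYSectESt 𝔸 G x ops 𝔏 𝔢 𝔴).QG1Qinv = ops.QG1Qinv := rfl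

variable (x) in
/-- at the FLAT star letters the layer's `Ck` kernel vanishes identically (the guard). [cite: Balaban1985BackgroundPropagators, Thm 3.15 (3.187) p.432, bookkeeping] -/
theorem operatorLayerYSectESt_Ck_ker_flat (U : (bg9Y 𝔸 G x).Cfg) (y y' : (geo9Y x).Site) :
    (operatorLayerYSectESt 𝔸 G x ops 𝔏 (sectELettersStY_flat 𝔸 x) 𝔴).Ck.ker U y y' = 0 := by
  haveI : Nonempty (BallY 𝔸) := ballY_nonempty
  rw [operatorLayerYSectESt_Ck_ker]
  have h0 : ∀ E : BallY 𝔸, ‖CkStY x 𝔏 (sectELettersStY_flat 𝔸 x) U (deltaY y' (E : 𝔸)) y‖ = 0 := fun E => by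
    rw [CkStY_flat, LinearMap.zero_apply]
    exact norm_zero
  simp_rw [h0]
  exact ciSup_const

end Layer

/-! ## §7 Record level: `SectEStY`, `opsYSectESt`, and the v4 instance at STAR Sect. E letters `opsYStOfRecordV4E` -/

section Record

open scoped Matrix.Norms.L2Operator
open B9Ineq349SiteReading (p349SiteY)

/-- the STAR Sect. E letters of a Stage 3′(Y) family: one `SectELettersStY` per member, `𝔸 = M_N(ℂ)`. [cite: Balaban1985BackgroundPropagators, (3.156)–(3.158) p.428, (3.185)–(3.186) p.432] -/
abbrev SectEStY (N : ℕ) (θ : Stage3Params) (Mstar : ℕ) : Type :=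
  ∀ x : MemberY θ.d₆ θ.ℓ₆ θ.hd' θ.hL' θ.b₀ θ.b₁ Mstar, SectELettersStY (Matrix (Fin N) (Fin N) ℂ) x

/-- the flat star Sect. E family (inhabitation). [cite: Balaban1985BackgroundPropagators, (3.156)–(3.158) p.428, bookkeeping] -/
def sectEStY_flat (N : ℕ) (θ : Stage3Params) (Mstar : ℕ) : SectEStY N θ Mstar := fun x => sectELettersStY_flat (Matrix (Fin N) (Fin N) ℂ) x

/-- ★ **the STAR Sect. E update of an `OpsY` layer family**, member by member `operatorLayerYSectESt` — generic in the base family `ops` and the letters `𝔏`.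
[cite: Balaban1985BackgroundPropagators, Thm 3.15 p.432, Thms 3.1–3.15 pp.397–432] -/
def opsYSectESt (N : ℕ) (θ : Stage3Params) (Mstar : ℕ) (ops : OpsY N θ Mstar) (𝔏 : LettersY N θ Mstar) (𝔢 : SectEStY N θ Mstar) (𝔴 : RWEY N θ Mstar) :
    OpsY N θ Mstar :=
  fun x => operatorLayerYSectESt (Matrix (Fin N) (Fin N) ℂ) (specialUnitaryUnits (Fin N)) x (ops x) (𝔏 x) (𝔢 x) (𝔴 x)

/-- ★★★ **THE v4 INSTANCE OF RECORD AT STAR SECT. E LETTERS**: def-Y's `opsYOfRecordV4E` shape — the v4 letters of record `lettersYOfRecordV4 … 𝔯`, n06-i's (3.49)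
site reading in the base family `opsYS349OfRecordV4 … 𝔯 𝔈` — with the STAR `C^{(k)}(Λ; U)` (3.156)–(3.158) and the star (3.185) slot over `𝔢 : SectEStY`
(generic; part 3's `sectEStYOfRecordV7 𝔢₀` is the star record of `Λ̃ ∕ C ∕ C*`; `𝔯 := resYOfC2 𝔠` gives the v7∕v8 residual shapes).
[cite: Balaban1985BackgroundPropagators, Thms 3.1–3.15 pp.397–432, (3.156)–(3.158) p.428; Balaban1984PropagatorsII, (2.3) p.224] -/
def opsYStOfRecordV4E (N : ℕ) (θ : Stage3Params) (Mstar : ℕ) (𝔯 : ResY N θ Mstar) (𝔢 : SectEStY N θ Mstar) (𝔴 : RWEY N θ Mstar)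
    (𝔈 : ExpsY N θ Mstar) : OpsY N θ Mstar :=
  opsYSectESt N θ Mstar (opsYS349OfRecordV4 N θ Mstar 𝔯 𝔈) (lettersYOfRecordV4 N θ Mstar 𝔯) 𝔢 𝔴

variable (N : ℕ) (θ : Stage3Params) (Mstar : ℕ) (𝔯 : ResY N θ Mstar) (𝔢 : SectEStY N θ Mstar) (𝔴 : RWEY N θ Mstar) (𝔈 : ExpsY N θ Mstar)

/-- the star instance at a member, unfolded. [cite: Balaban1985BackgroundPropagators, Thm 3.15 p.432, bookkeeping] -/
theorem opsYStOfRecordV4E_apply (x : MemberY θ.d₆ θ.ℓ₆ θ.hd' θ.hL' θ.b₀ θ.b₁ Mstar) :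
    opsYStOfRecordV4E N θ Mstar 𝔯 𝔢 𝔴 𝔈 x =
      operatorLayerYSectESt (Matrix (Fin N) (Fin N) ℂ) (specialUnitaryUnits (Fin N)) x (opsYS349OfRecordV4 N θ Mstar 𝔯 𝔈 x)
        (lettersYOfRecordV4 N θ Mstar 𝔯 x) (𝔢 x) (𝔴 x) := rfl

/-- ★ ROW 24's kernel at the star instance: the index-bond reading of the STAR `C^{(k)}(Λ; ·)` over the v4 letters of record. [cite: Balaban1985BackgroundPropagators, Thm 3.15 (3.187) p.432, bookkeeping] -/
theorem opsYStOfRecordV4E_Ck (x : MemberY θ.d₆ θ.ℓ₆ θ.hd' θ.hL' θ.b₀ θ.b₁ Mstar) :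
    (opsYStOfRecordV4E N θ Mstar 𝔯 𝔢 𝔴 𝔈 x).Ck =
      siteKernelOfOp x.toKIdx (bg9Y (Matrix (Fin N) (Fin N) ℂ) (specialUnitaryUnits (Fin N)) x) (fun U => U)
        (CkStY x (lettersYOfRecordV4 N θ Mstar 𝔯 x) (𝔢 x)) id id := rfl

/-- ★ ROW 24's kernel entry at the star instance. [cite: Balaban1985BackgroundPropagators, Thm 3.15 (3.187) p.432, bookkeeping] -/
theorem opsYStOfRecordV4E_Ck_ker (x : MemberY θ.d₆ θ.ℓ₆ θ.hd' θ.hL' θ.b₀ θ.b₁ Mstar)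
    (U : (bg9Y (Matrix (Fin N) (Fin N) ℂ) (specialUnitaryUnits (Fin N)) x).Cfg) (y y' : (geo9Y x).Site) :
    (opsYStOfRecordV4E N θ Mstar 𝔯 𝔢 𝔴 𝔈 x).Ck.ker U y y' =
      ⨆ E : BallY (Matrix (Fin N) (Fin N) ℂ), ‖CkStY x (lettersYOfRecordV4 N θ Mstar 𝔯 x) (𝔢 x) U (deltaY y' (E : Matrix (Fin N) (Fin N) ℂ)) y‖ := rfl

/-- ★ ROW 24's (3.185) slot at the star instance IS the pinned star (3.185) equation. [cite: Balaban1985BackgroundPropagators, Thm 3.15 (3.185) p.432, bookkeeping] -/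
theorem opsYStOfRecordV4E_GivenBy3185 (x : MemberY θ.d₆ θ.ℓ₆ θ.hd' θ.hL' θ.b₀ θ.b₁ Mstar) :
    (opsYStOfRecordV4E N θ Mstar 𝔯 𝔢 𝔴 𝔈 x).GivenBy3185 = givenBy3185stY x (lettersYOfRecordV4 N θ Mstar 𝔯 x) (𝔢 x) := rfl

/-- ★ ROW 24's expansion slot at the star instance (unchanged walk slot). [cite: Balaban1985BackgroundPropagators, Thm 3.15 p.432, bookkeeping] -/
theorem opsYStOfRecordV4E_HasRWExpC (x : MemberY θ.d₆ θ.ℓ₆ θ.hd' θ.hL' θ.b₀ θ.b₁ Mstar) :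
    (opsYStOfRecordV4E N θ Mstar 𝔯 𝔢 𝔴 𝔈 x).HasRWExpC = hasRWExpCY (𝔴 x) := rfl

/-- ROW 25's letter at the star instance IS n06-i's site-sector (3.49) reading (the base family's). [cite: Balaban1985BackgroundPropagators, (3.49) p.399, bookkeeping] -/
theorem opsYStOfRecordV4E_P349 (x : MemberY θ.d₆ θ.ℓ₆ θ.hd' θ.hL' θ.b₀ θ.b₁ Mstar) :
    (opsYStOfRecordV4E N θ Mstar 𝔯 𝔢 𝔴 𝔈 x).P349 = (opsYS349OfRecordV4 N θ Mstar 𝔯 𝔈 x).P349 := rfl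

/-- the other rows' operator letters at the star instance ARE the v4 base family's (`Gp GA Cinv GD G₁ H H₁ GG Kdiff QGQinv QG1Qinv`, `rfl`) — and hence those of
def-Y's `opsYOfRecordV4E` at the same `𝔯`, `𝔈`. [cite: Balaban1985BackgroundPropagators, Thms 3.1–3.14 pp.397–427, (3.132) p.422, bookkeeping] -/
theorem opsYStOfRecordV4E_letters (x : MemberY θ.d₆ θ.ℓ₆ θ.hd' θ.hL' θ.b₀ θ.b₁ Mstar) (𝔢' : SectEY N θ Mstar) :
    (opsYStOfRecordV4E N θ Mstar 𝔯 𝔢 𝔴 𝔈 x).Gp = (opsYOfRecordV4E N θ Mstar 𝔯 𝔢' 𝔴 𝔈 x).Gp ∧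
      (opsYStOfRecordV4E N θ Mstar 𝔯 𝔢 𝔴 𝔈 x).GA = (opsYOfRecordV4E N θ Mstar 𝔯 𝔢' 𝔴 𝔈 x).GA ∧
      (opsYStOfRecordV4E N θ Mstar 𝔯 𝔢 𝔴 𝔈 x).Cinv = (opsYOfRecordV4E N θ Mstar 𝔯 𝔢' 𝔴 𝔈 x).Cinv ∧
      (opsYStOfRecordV4E N θ Mstar 𝔯 𝔢 𝔴 𝔈 x).GD = (opsYOfRecordV4E N θ Mstar 𝔯 𝔢' 𝔴 𝔈 x).GD ∧
      (opsYStOfRecordV4E N θ Mstar 𝔯 𝔢 𝔴 𝔈 x).G₁ = (opsYOfRecordV4E N θ Mstar 𝔯 𝔢' 𝔴 𝔈 x).G₁ ∧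
      (opsYStOfRecordV4E N θ Mstar 𝔯 𝔢 𝔴 𝔈 x).H = (opsYOfRecordV4E N θ Mstar 𝔯 𝔢' 𝔴 𝔈 x).H ∧
      (opsYStOfRecordV4E N θ Mstar 𝔯 𝔢 𝔴 𝔈 x).H₁ = (opsYOfRecordV4E N θ Mstar 𝔯 𝔢' 𝔴 𝔈 x).H₁ ∧
      (opsYStOfRecordV4E N θ Mstar 𝔯 𝔢 𝔴 𝔈 x).GG = (opsYOfRecordV4E N θ Mstar 𝔯 𝔢' 𝔴 𝔈 x).GG ∧
      (opsYStOfRecordV4E N θ Mstar 𝔯 𝔢 𝔴 𝔈 x).Kdiff = (opsYOfRecordV4E N θ Mstar 𝔯 𝔢' 𝔴 𝔈 x).Kdiff ∧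
      (opsYStOfRecordV4E N θ Mstar 𝔯 𝔢 𝔴 𝔈 x).QGQinv = (opsYOfRecordV4E N θ Mstar 𝔯 𝔢' 𝔴 𝔈 x).QGQinv ∧
      (opsYStOfRecordV4E N θ Mstar 𝔯 𝔢 𝔴 𝔈 x).QG1Qinv = (opsYOfRecordV4E N θ Mstar 𝔯 𝔢' 𝔴 𝔈 x).QG1Qinv ∧
      (opsYStOfRecordV4E N θ Mstar 𝔯 𝔢 𝔴 𝔈 x).P349 = (opsYOfRecordV4E N θ Mstar 𝔯 𝔢' 𝔴 𝔈 x).P349 ∧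
      (opsYStOfRecordV4E N θ Mstar 𝔯 𝔢 𝔴 𝔈 x).HasRWExpC = (opsYOfRecordV4E N θ Mstar 𝔯 𝔢' 𝔴 𝔈 x).HasRWExpC :=
  ⟨rfl, rfl, rfl, rfl, rfl, rfl, rfl, rfl, rfl, rfl, rfl, rfl, rfl⟩

/-- … and its expansion ∕ predicate letters are `𝔈`'s. [cite: Balaban1985BackgroundPropagators, Thms 3.7–3.13 pp.409–426, bookkeeping] -/
theorem opsYStOfRecordV4E_exps (x : MemberY θ.d₆ θ.ℓ₆ θ.hd' θ.hL' θ.b₀ θ.b₁ Mstar) :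
    (opsYStOfRecordV4E N θ Mstar 𝔯 𝔢 𝔴 𝔈 x).E37 = (𝔈 x).E37 ∧ (opsYStOfRecordV4E N θ Mstar 𝔯 𝔢 𝔴 𝔈 x).EK39 = (𝔈 x).EK39 ∧
      (opsYStOfRecordV4E N θ Mstar 𝔯 𝔢 𝔴 𝔈 x).E310 = (𝔈 x).E310 ∧ (opsYStOfRecordV4E N θ Mstar 𝔯 𝔢 𝔴 𝔈 x).PosDef = (𝔈 x).PosDef ∧
      (opsYStOfRecordV4E N θ Mstar 𝔯 𝔢 𝔴 𝔈 x).IsAnalyticExt = (𝔈 x).IsAnalyticExt ∧ (opsYStOfRecordV4E N θ Mstar 𝔯 𝔢 𝔴 𝔈 x).HasRWExp = (𝔈 x).HasRWExp ∧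
      (opsYStOfRecordV4E N θ Mstar 𝔯 𝔢 𝔴 𝔈 x).HasRWExpH = (𝔈 x).HasRWExpH ∧ (opsYStOfRecordV4E N θ Mstar 𝔯 𝔢 𝔴 𝔈 x).PosDefK = (𝔈 x).PosDefK :=
  ⟨rfl, rfl, rfl, rfl, rfl, rfl, rfl, rfl⟩

/-- the [B9] bundle of record at the star instance. [cite: Balaban1985BackgroundPropagators, Thms 3.1–3.15 pp.397–432, bookkeeping] -/
theorem Y9OfRecord_opsYStOfRecordV4E :
    Y9OfRecord N θ Mstar (opsYStOfRecordV4E N θ Mstar 𝔯 𝔢 𝔴 𝔈) =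
      carriersY θ.d₆ θ.ℓ₆ θ.hd' θ.hL' θ.b₀ θ.b₁ Mstar (Matrix (Fin N) (Fin N) ℂ) (specialUnitaryUnits (Fin N)) (opsYStOfRecordV4E N θ Mstar 𝔯 𝔢 𝔴 𝔈) := rfl

/-- at the FLAT star family the instance's `Ck` kernel vanishes identically (row 24 vacuous there). [cite: Balaban1985BackgroundPropagators, Thm 3.15 (3.187) p.432, bookkeeping] -/
theorem opsYStOfRecordV4E_Ck_ker_flat (x : MemberY θ.d₆ θ.ℓ₆ θ.hd' θ.hL' θ.b₀ θ.b₁ Mstar)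
    (U : (bg9Y (Matrix (Fin N) (Fin N) ℂ) (specialUnitaryUnits (Fin N)) x).Cfg) (y y' : (geo9Y x).Site) :
    (opsYStOfRecordV4E N θ Mstar 𝔯 (sectEStY_flat N θ Mstar) 𝔴 𝔈 x).Ck.ker U y y' = 0 :=
  operatorLayerYSectESt_Ck_ker_flat x (opsYS349OfRecordV4 N θ Mstar 𝔯 𝔈 x) (lettersYOfRecordV4 N θ Mstar 𝔯 x) (𝔴 x) U y y'

/-- ★ **ROW 24 (`t315`) AT THE STAR INSTANCE, UNFOLDED** (`Iff.rfl`): r1's `Thm315FullPrinted` at `opsYStOfRecordV4E` IS the printed Theorem 3.15 about the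
index-bond kernel of the STAR `C^{(k)}(Λ; U) = CkStY` over the v4 letters of record and the star letters `𝔢`, with «given by the formula (3.185)» = `givenBy3185stY`
and the expansion clause = `hasRWExpCY (𝔴 x)` (kernel rows indexed by `inΛY` pairs, unchanged). [cite: Balaban1985BackgroundPropagators, Thm 3.15 (3.185)–(3.187) p.432] -/
theorem t315_opsYStOfRecordV4E_iff :
    B9.Thm315FullPrinted c35Y geo9Y (bg9Y (Matrix (Fin N) (Fin N) ℂ) (specialUnitaryUnits (Fin N)))
        (fun x => (opsYStOfRecordV4E N θ Mstar 𝔯 𝔢 𝔴 𝔈 x).Ck) inΛY unitDistY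
        (fun x => (opsYStOfRecordV4E N θ Mstar 𝔯 𝔢 𝔴 𝔈 x).GivenBy3185) (fun x => (opsYStOfRecordV4E N θ Mstar 𝔯 𝔢 𝔴 𝔈 x).HasRWExpC) ↔
      B9.Thm315FullPrinted c35Y geo9Y (bg9Y (Matrix (Fin N) (Fin N) ℂ) (specialUnitaryUnits (Fin N)))
        (fun x => siteKernelOfOp x.toKIdx (bg9Y (Matrix (Fin N) (Fin N) ℂ) (specialUnitaryUnits (Fin N)) x) (fun U => U)
          (CkStY x (lettersYOfRecordV4 N θ Mstar 𝔯 x) (𝔢 x)) id id) inΛY unitDistY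
        (fun x => givenBy3185stY x (lettersYOfRecordV4 N θ Mstar 𝔯 x) (𝔢 x)) (fun x => hasRWExpCY (𝔴 x)) := Iff.rfl

/-- THE HONESTY GUARD: at the FLAT star Sect. E family and the FLAT walk letters row 24 holds OUTRIGHT at the star instance (kernel `0`, both slots trivially
inhabited) — content enters exactly with GENUINE star letters (part 3's record), never by the typing alone. [cite: Balaban1985BackgroundPropagators, Thm 3.15 (3.185)–(3.187) p.432, bookkeeping] -/
theorem t315_opsYStOfRecordV4E_flat {δ₀ : ℝ} (hδ₀ : 0 < δ₀) :
    B9.Thm315FullPrinted c35Y geo9Y (bg9Y (Matrix (Fin N) (Fin N) ℂ) (specialUnitaryUnits (Fin N)))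
      (fun x => (opsYStOfRecordV4E N θ Mstar 𝔯 (sectEStY_flat N θ Mstar) (rwEY_flat N θ Mstar) 𝔈 x).Ck) inΛY unitDistY
      (fun x => (opsYStOfRecordV4E N θ Mstar 𝔯 (sectEStY_flat N θ Mstar) (rwEY_flat N θ Mstar) 𝔈 x).GivenBy3185)
      (fun x => (opsYStOfRecordV4E N θ Mstar 𝔯 (sectEStY_flat N θ Mstar) (rwEY_flat N θ Mstar) 𝔈 x).HasRWExpC) :=
  ⟨δ₀, 1, 1, hδ₀, one_pos, one_pos, fun x _ _ _ U _ _ =>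
    ⟨givenBy3185stY_flat x _ U, hasRWExpCY_flat _ _ x U δ₀, fun y y' _ _ => by
      rw [opsYStOfRecordV4E_Ck_ker_flat, abs_zero]
      exact mul_nonneg zero_le_one (Real.exp_nonneg _)⟩⟩

end Record

end Literature.MathematicalPhysics.QuantumFieldTheory.Balaban1983to89.Node00

end
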